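import Literature.MathematicalPhysics.QuantumFieldTheory.Balaban1983to89.B6Prop27KLevelV1
import HarnessLib

/-!
# `Balaban1983to89.B6QGQTestBumpsKLevelV1` — T. Bałaban, *Propagators and renormalization transformations for lattice gauge theories. II*,
Comm. Math. Phys. **96** (1984) 223–250 [Balaban1984PropagatorsII], **the test fields for the lower bound (2.147) on `QGQ*` AT
k LEVELS** (ROUTE W file W1, part 1 of 2; part 2 = `B6QGQCoerciveKLevelV1`; B6-CLOSURE §5 item 17, design v2).

HONEST FRAMING (programme rule): statement-level skeleton of published theorems with citation tags; proofs where landed; nothing here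
is a claim about the Yang–Mills mass gap.  The print's argument for (2.147) is
«The operator C is an inverse to the operator of the quadratic form (2.120), hence it is bounded from below by an inverse of an
upper bound of this form. Taking into account that ‖B₁‖² is bounded from below by const‖B‖², we get ⟨B,(QGQ*)B⟩ ≥ γ₀‖B‖² (2.147)
with a positive constant γ₀ depending on d and L only» (p. 248); this file and its sequel are OUR explicit
realisation of that lower bound on ROUTE V's torus model (`B6GlobalChartV1.domT`) — the same mechanism («bounded from below by an inverse
of an upper bound of this form» = the variational principle of §1) with integer tent test fields on the carrier blocks supplying the upper
bound of the form; all constants explicit and k-uniform (ours depend on `d`, `L` and the band constant `b₁` of (2.16), the weights being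
assumed in the band only).

## WHAT THIS FILE CERTIFIES (kernel-checked, sorry-free, standard axioms)

* §1 **`inner_GE_ge_of_test`** (`⟪φ,u⟫²/⟪φ,Δ_aφ⟫ ≤ ⟪u,Gu⟫` for `G = Δ_a⁻¹`, any `Domains` datum) and **`qgq_coercive_of_test_map`** (a linear
  test map `Φ` with `⟪QΦv, v⟫ ≥ a·S(v)` and `⟪Φv, Δ_aΦv⟫ ≤ b·S(v)` gives `(a²/b)·S(v) ≤ ⟪Q*v, GQ*v⟫`).
* §2–§3 block coordinates `loc` (`sum_block_prod`: a product density sums to the product of the coordinate sums), runs across a block, and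
  **the exact averaging weights of the multi-scale `Q` on a carrier block** (`qwt_src`: `c_Q(j)·(loc_μ + 1)` on `B^j(b₋)`, `qwt_tgt`:
  `c_Q(j)·(L^j − 1 − loc_μ)` on `B^j(b₊)`, zero elsewhere / other directions).
* §4 the tent bumps `φ_i` on the base block of the index bond `i` (longitudinal `τ(u) = max(0, r − |u − ctr|)`, `r = ⌊L^j/5⌋`, centre fitted to
  the case `b₋ ∈ Ω_j` / `b₋ ∉ Ω_j`; transverse `τ_⊥(c) = min(c+1, L^j − c)`), and the pairings `(Qφ_i)_{i′}` in closed form (`pair_src`,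
  `pair_tgt`, `pair_le`, vanishing for other directions / disjoint blocks).
* §5 the rows: `mass_eq` (`m_i = c_Q(L^j − r)·Στ·(Στ_⊥)^d > 0`), `partner_eq/le` (a same-level partner row is exactly `r/(L^j − r) ≤ ¼` of the
  mass), `level_window` (nonzero rows have level `j` or `j+1`), keys (`ext_of_key`, `card_key_le_one`), `sum_qwt_level_le`, and the coarse
  counts `card_coarse_rows_le ≤ 2`, `card_fine_seen_le ≤ 2L^D`.
* §6a–§6c `energy_le` (`⟪A, Δ_aA⟫ ≤ c_f²(D+2)·Σ_fΣ_ν(Δ_νA)(f)² + Σ_i w_i(QA)_i²`), locality `grad_sq_le` (`4D`), `qrow_sq_le` (`4D·L^D`),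
  and the `Q`-energy of one bump `qenergy_bump_le`.

## HONEST SCOPE

Everything is bookkeeping for the sequel's `qgq_coercive_kLevel`; the standing hypotheses appear lemma by lemma (`1 ≤ k`, `4 ≤ ℓ`,
`2 ≤ R·M̂`, torus periods `≥ 2`).  No statement of the print is asserted here beyond the cited dictionary items.
-/

namespace Literature.MathematicalPhysics.QuantumFieldTheory.Balaban1983to89.B6QGQTestBumpsKLevelV1

open scoped InnerProductSpace
open LatticeFieldCalculus
open B6SectADomainsV1 (Domains)
open B6SectAOperatorsV1 (QE QsE BondIdx BondIdxSpace inner_QsE_left)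
open B6SectAVectorModelV1 (GE deltaAE inner_GE_left deltaAE_GE inner_deltaAE_left inner_deltaAE_self_nonneg
  eq_zero_of_inner_deltaAE_self_eq_zero inner_GE_pos)
open BalabanImbrieJaffe1984to88.BIJ85AxialPropagator411 (BondSpace)

noncomputable section

/-! ## §1  The variational principle and the abstract assembly -/

section Variational

variable {P : Params} (Dm : Domains P) {c : ℝ} (hc : c ≠ 0) {w : BondIdx Dm → ℝ} (hw : ∀ i, 0 < w i)

/-- `⟪u, Gu⟫ ≥ 0`. [cite: Balaban1984PropagatorsII, p.228 («a well-defined and positive operator»)] -/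
theorem inner_GE_self_nonneg (u : BondSpace P) : 0 ≤ ⟪u, GE Dm hc hw u⟫_ℝ := by
  by_cases hu : u = 0
  · rw [hu, inner_zero_left]
  · exact (inner_GE_pos Dm hc hw hu).le

/-- **THE VARIATIONAL PRINCIPLE**: for `G = Δ_a⁻¹` (`Δ_a` symmetric, positive definite) and every test field `φ` with `⟪φ, Δ_aφ⟫ > 0`,
`⟪φ, u⟫²/⟪φ, Δ_aφ⟫ ≤ ⟪u, Gu⟫` — the mechanism of the lower bound (2.147) (p. 248: the inverse of a form «is bounded from below by an
inverse of an upper bound of this form»). [cite: Balaban1984PropagatorsII, (2.147) p.248; Balaban1983RegularityDecay, (5.6) p.594, bookkeeping] -/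
theorem inner_GE_ge_of_test (u φ : BondSpace P) (hφ : 0 < ⟪φ, deltaAE Dm c w φ⟫_ℝ) :
    ⟪φ, u⟫_ℝ ^ 2 / ⟪φ, deltaAE Dm c w φ⟫_ℝ ≤ ⟪u, GE Dm hc hw u⟫_ℝ := by
  set g := GE Dm hc hw u with hg
  set E := ⟪φ, deltaAE Dm c w φ⟫_ℝ with hE
  set t := ⟪φ, u⟫_ℝ / E with ht
  have hΔg : deltaAE Dm c w g = u := deltaAE_GE Dm hc hw u
  -- `0 ≤ ⟪g − tφ, Δ_a(g − tφ)⟫ = ⟪u, Gu⟫ − 2t⟪φ, u⟫ + t²E`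
  have h0 := inner_deltaAE_self_nonneg Dm c (fun i => (hw i).le) (g - t • φ)
  have hexp : ⟪g - t • φ, deltaAE Dm c w (g - t • φ)⟫_ℝ = ⟪u, g⟫_ℝ - 2 * t * ⟪φ, u⟫_ℝ + t ^ 2 * E := by
    rw [map_sub, map_smul, hΔg, inner_sub_left, inner_sub_right, inner_sub_right, inner_smul_left, inner_smul_left,
      inner_smul_right, inner_smul_right, real_inner_comm u g]
    have h1 : ⟪g, deltaAE Dm c w φ⟫_ℝ = ⟪φ, u⟫_ℝ := by rw [← inner_deltaAE_left, hΔg, real_inner_comm]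
    rw [h1, ← hE]
    simp only [conj_trivial]
    rw [hg, real_inner_comm (GE Dm hc hw u) u]
    ring
  rw [hexp] at h0
  have hkey : ⟪u, g⟫_ℝ - 2 * t * ⟪φ, u⟫_ℝ + t ^ 2 * E = ⟪u, g⟫_ℝ - ⟪φ, u⟫_ℝ ^ 2 / E := by
    rw [ht]; field_simp; ring
  rw [hkey] at h0
  linarith

/-- **THE ABSTRACT ASSEMBLY OF (2.147)**: a linear test map `Φ : L²(𝔅) → L²(bonds)` with `a·S(v) ≤ ⟪QΦv, v⟫` and `⟪Φv, Δ_aΦv⟫ ≤ b·S(v)` for all `v`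
(`S ≥ 0`, `a, b > 0`) gives the coercivity `(a²/b)·S(v) ≤ ⟪Q*v, GQ*v⟫`. [cite: Balaban1984PropagatorsII, (2.147) p.248, bookkeeping] -/
theorem qgq_coercive_of_test_map (Φ : BondIdxSpace Dm →ₗ[ℝ] BondSpace P) (S : BondIdxSpace Dm → ℝ) (hS0 : ∀ v, 0 ≤ S v)
    {a b : ℝ} (ha : 0 < a) (hb : 0 < b) (hT : ∀ v, a * S v ≤ ⟪QE Dm (Φ v), v⟫_ℝ)
    (hEn : ∀ v, ⟪Φ v, deltaAE Dm c w (Φ v)⟫_ℝ ≤ b * S v) (v : BondIdxSpace Dm) :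
    a ^ 2 / b * S v ≤ ⟪QsE Dm v, GE Dm hc hw (QsE Dm v)⟫_ℝ := by
  rcases (hS0 v).eq_or_lt with hS | hS
  · rw [← hS, mul_zero]; exact inner_GE_self_nonneg Dm hc hw _
  · -- the energy of `Φv` is positive
    set E := ⟪Φ v, deltaAE Dm c w (Φ v)⟫_ℝ with hE
    have hpair : ⟪Φ v, QsE Dm v⟫_ℝ = ⟪QE Dm (Φ v), v⟫_ℝ := by
      rw [real_inner_comm, inner_QsE_left, real_inner_comm]
    have hTv := hT v
    have hEpos : 0 < E := by
      rcases (inner_deltaAE_self_nonneg Dm c (fun i => (hw i).le) (Φ v)).eq_or_lt with h0 | h0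
      · exfalso
        have hz : Φ v = 0 := eq_zero_of_inner_deltaAE_self_eq_zero Dm hc hw h0.symm
        rw [hz, map_zero, inner_zero_left] at hTv
        nlinarith
      · exact h0
    have hvar := inner_GE_ge_of_test Dm hc hw (QsE Dm v) (Φ v) hEpos
    rw [hpair] at hvar
    -- `a²S² / (bS) ≤ ⟪QΦv, v⟫² / E`
    have h1 : a ^ 2 / b * S v ≤ (a * S v) ^ 2 / E := by
      rw [div_mul_eq_mul_div, le_div_iff₀ hEpos, div_mul_eq_mul_div, div_le_iff₀ hb]
      have := hEn v
      nlinarith [mul_pos (pow_pos ha 2) (mul_pos hS hS)]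
    have h2 : (a * S v) ^ 2 / E ≤ ⟪QE Dm (Φ v), v⟫_ℝ ^ 2 / E :=
      div_le_div_of_nonneg_right (pow_le_pow_left₀ (by positivity) hTv 2) hEpos.le
    exact h1.trans (h2.trans hvar)

end Variational

/-! ## §2  Block-local coordinates on the V1 torus: `B^n(y) ≅ [0, L^n)^D` -/

section Coord

open B5Eq118OneStroke (iterBlock iterBlockOf mem_iterBlock mem_iterBlock_iff val_iterBlockOf)
open B6GlobalChartV1 (PV)
open B6AgreeQaQV1Chart (sitesPerDir_zero_eq_mul)
open B6Ineq2142KLevelV1 (val_runSite_self runSite_apply_of_ne)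

variable {d ℓ m K : ℕ} {hd : 1 ≤ d + 1} {hL : Odd (ℓ + 1) ∧ 1 < ℓ + 1} {n : ℕ}

/-- the block-local coordinate of a fine site in direction `μ`: `x_μ mod L^n ∈ [0, L^n)`. [cite: Balaban1984PropagatorsI, (1.6) p.18, dictionary] -/
def loc (n : ℕ) (x : Site (PV d ℓ m K hd hL) 0) (μ : Fin (d + 1)) : ℕ := (x μ).val % (ℓ + 1) ^ n

/-- `loc < L^n`. [cite: Balaban1984PropagatorsI, (1.6) p.18, bookkeeping] -/
theorem loc_lt (n : ℕ) (x : Site (PV d ℓ m K hd hL) 0) (μ : Fin (d + 1)) : loc n x μ < (ℓ + 1) ^ n :=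
  Nat.mod_lt _ (by positivity)

/-- in the block `B^n(y)`: `x_μ = y_μ·L^n + loc`. [cite: Balaban1984PropagatorsI, (1.6) p.18, dictionary] -/
theorem val_eq_of_mem (hn : n ≤ m + K) {y : Site (PV d ℓ m K hd hL) n} {x : Site (PV d ℓ m K hd hL) 0} (hx : x ∈ iterBlock n y)
    (μ : Fin (d + 1)) : (x μ).val = (y μ).val * (ℓ + 1) ^ n + loc n x μ := by
  rw [mem_iterBlock_iff hn] at hx
  have h := Nat.div_add_mod (x μ).val ((ℓ + 1) ^ n)
  rw [hx μ] at h
  unfold loc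
  linarith [mul_comm ((ℓ + 1) ^ n) (y μ).val]

/-- the fine site of `B^n(y)` with local coordinates `c`. [cite: Balaban1984PropagatorsI, (1.6) p.18, dictionary] -/
def ofLoc (n : ℕ) (y : Site (PV d ℓ m K hd hL) n) (c : Fin (d + 1) → Fin ((ℓ + 1) ^ n)) : Site (PV d ℓ m K hd hL) 0 :=
  fun μ => (((y μ).val * (ℓ + 1) ^ n + c μ : ℕ) : ZMod ((PV d ℓ m K hd hL).sitesPerDir 0))

/-- its labels. [cite: Balaban1984PropagatorsI, (1.6) p.18, bookkeeping] -/
theorem ofLoc_val (hn : n ≤ m + K) (y : Site (PV d ℓ m K hd hL) n) (c : Fin (d + 1) → Fin ((ℓ + 1) ^ n)) (μ : Fin (d + 1)) :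
    ((ofLoc n y c) μ).val = (y μ).val * (ℓ + 1) ^ n + c μ := by
  unfold ofLoc
  rw [ZMod.val_natCast, Nat.mod_eq_of_lt]
  have hy : (y μ).val < (PV d ℓ m K hd hL).sitesPerDir n := ZMod.val_lt _
  have hc : (c μ : ℕ) < (ℓ + 1) ^ n := (c μ).2
  have hmul := sitesPerDir_zero_eq_mul (PV d ℓ m K hd hL) hn
  have hL' : (PV d ℓ m K hd hL).L = ℓ + 1 := rfl
  rw [hL'] at hmul
  rw [hmul]
  calc (y μ).val * (ℓ + 1) ^ n + c μ < (y μ).val * (ℓ + 1) ^ n + (ℓ + 1) ^ n := by omega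
    _ = ((y μ).val + 1) * (ℓ + 1) ^ n := by ring
    _ ≤ (PV d ℓ m K hd hL).sitesPerDir n * (ℓ + 1) ^ n := Nat.mul_le_mul_right _ hy
    _ = (ℓ + 1) ^ n * (PV d ℓ m K hd hL).sitesPerDir n := mul_comm _ _

/-- `ofLoc y c ∈ B^n(y)`. [cite: Balaban1984PropagatorsI, (1.6) p.18, bookkeeping] -/
theorem ofLoc_mem (hn : n ≤ m + K) (y : Site (PV d ℓ m K hd hL) n) (c : Fin (d + 1) → Fin ((ℓ + 1) ^ n)) :
    ofLoc n y c ∈ iterBlock n y := by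
  rw [mem_iterBlock_iff hn]
  intro μ
  rw [ofLoc_val hn, mul_comm, Nat.mul_add_div (by positivity), Nat.div_eq_of_lt (c μ).2, add_zero]

/-- `loc (ofLoc y c) = c`. [cite: Balaban1984PropagatorsI, (1.6) p.18, bookkeeping] -/
theorem loc_ofLoc (hn : n ≤ m + K) (y : Site (PV d ℓ m K hd hL) n) (c : Fin (d + 1) → Fin ((ℓ + 1) ^ n)) (μ : Fin (d + 1)) :
    loc n (ofLoc n y c) μ = c μ := by
  unfold loc
  rw [ofLoc_val hn, mul_comm, Nat.mul_add_mod, Nat.mod_eq_of_lt (c μ).2]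

/-- `ofLoc y (loc x) = x` on the block. [cite: Balaban1984PropagatorsI, (1.6) p.18, bookkeeping] -/
theorem ofLoc_loc (hn : n ≤ m + K) {y : Site (PV d ℓ m K hd hL) n} {x : Site (PV d ℓ m K hd hL) 0} (hx : x ∈ iterBlock n y) :
    ofLoc n y (fun μ => ⟨loc n x μ, loc_lt n x μ⟩) = x := by
  funext μ
  apply ZMod.val_injective
  rw [ofLoc_val hn, ← val_eq_of_mem hn hx]

/-- `ofLoc y` is injective. [cite: Balaban1984PropagatorsI, (1.6) p.18, bookkeeping] -/
theorem ofLoc_injective (hn : n ≤ m + K) (y : Site (PV d ℓ m K hd hL) n) : Function.Injective (ofLoc n y) := by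
  intro c c' h
  funext μ
  apply Fin.ext
  have h1 := loc_ofLoc hn y c μ
  have h2 := loc_ofLoc hn y c' μ
  rw [h] at h1
  rw [h1] at h2
  exact h2

/-- **SUMS OVER A BLOCK IN LOCAL COORDINATES**: `Σ_{x ∈ B^n(y)} g(x) = Σ_{c ∈ [0,L^n)^D} g(ofLoc y c)`. [cite: Balaban1984PropagatorsI, (1.6)/(1.18) p.18–20, bookkeeping] -/
theorem sum_block_eq_sum_loc (hn : n ≤ m + K) (y : Site (PV d ℓ m K hd hL) n) (g : Site (PV d ℓ m K hd hL) 0 → ℝ) :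
    ∑ x ∈ iterBlock n y, g x = ∑ c : Fin (d + 1) → Fin ((ℓ + 1) ^ n), g (ofLoc n y c) := by
  classical
  rw [← Finset.sum_image (f := g) (s := Finset.univ) (g := ofLoc n y) fun c _ c' _ h => ofLoc_injective hn y h]
  apply Finset.sum_congr _ fun _ _ => rfl
  ext x
  rw [Finset.mem_image]
  constructor
  · intro hx
    exact ⟨fun μ => ⟨loc n x μ, loc_lt n x μ⟩, Finset.mem_univ _, ofLoc_loc hn hx⟩
  · rintro ⟨c, -, rfl⟩
    exact ofLoc_mem hn y c

/-- **FUBINI ON A BLOCK**: `Σ_{x ∈ B^n(y)} Π_μ g_μ(loc_μ x) = Π_μ Σ_{t < L^n} g_μ(t)`. [cite: Balaban1984PropagatorsI, (1.18) p.20, bookkeeping] -/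
theorem sum_block_prod (hn : n ≤ m + K) (y : Site (PV d ℓ m K hd hL) n) (g : Fin (d + 1) → ℕ → ℝ) :
    ∑ x ∈ iterBlock n y, ∏ μ, g μ (loc n x μ) = ∏ μ : Fin (d + 1), ∑ t : Fin ((ℓ + 1) ^ n), g μ t := by
  rw [sum_block_eq_sum_loc hn, Finset.prod_univ_sum]
  simp only [Fintype.piFinset_univ]
  exact Finset.sum_congr rfl fun c _ => Finset.prod_congr rfl fun μ _ => by rw [loc_ofLoc hn]

/-- **A RUN INSIDE THE BLOCK**: if `loc_μ x + t < L^n` then `x + te_μ ∈ B^n(y)` with `loc_μ = loc_μ x + t`, the other local coordinates unchanged.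
[cite: Balaban1984PropagatorsI, (1.7) p.18 (the line-segment contours `Γ_{y,x}`), bookkeeping] -/
theorem runSite_mem_of_loc (hn : n ≤ m + K) {y : Site (PV d ℓ m K hd hL) n} {x : Site (PV d ℓ m K hd hL) 0} (hx : x ∈ iterBlock n y)
    (μ : Fin (d + 1)) {t : ℕ} (ht : loc n x μ + t < (ℓ + 1) ^ n) :
    runSite x μ t ∈ iterBlock n y ∧ loc n (runSite x μ t) μ = loc n x μ + t ∧ ∀ ν, ν ≠ μ → loc n (runSite x μ t) ν = loc n x ν := by
  have hxv := val_eq_of_mem hn hx μ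
  have hval : ((runSite x μ t) μ).val = (x μ).val + t := by
    rw [val_runSite_self, Nat.mod_eq_of_lt]
    have hmul := sitesPerDir_zero_eq_mul (PV d ℓ m K hd hL) hn
    have hL' : (PV d ℓ m K hd hL).L = ℓ + 1 := rfl
    rw [hL'] at hmul
    refine lt_of_lt_of_le ?_ (le_of_eq hmul.symm)
    rw [hxv]
    have hy : (y μ).val < (PV d ℓ m K hd hL).sitesPerDir n := ZMod.val_lt _
    calc (y μ).val * (ℓ + 1) ^ n + loc n x μ + t < ((y μ).val + 1) * (ℓ + 1) ^ n := by rw [add_mul, one_mul, add_assoc]; omega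
      _ ≤ (PV d ℓ m K hd hL).sitesPerDir n * (ℓ + 1) ^ n := Nat.mul_le_mul_right _ hy
      _ = (ℓ + 1) ^ n * (PV d ℓ m K hd hL).sitesPerDir n := mul_comm _ _
  have hother : ∀ ν, ν ≠ μ → loc n (runSite x μ t) ν = loc n x ν := fun ν hν => by
    unfold loc; rw [runSite_apply_of_ne x hν]
  have hlocμ : loc n (runSite x μ t) μ = loc n x μ + t := by
    show ((runSite x μ t) μ).val % (ℓ + 1) ^ n = loc n x μ + t
    rw [hval, hxv, add_assoc, mul_comm, Nat.mul_add_mod, Nat.mod_eq_of_lt ht]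
  refine ⟨?_, hlocμ, hother⟩
  rw [mem_iterBlock_iff hn] at hx ⊢
  intro ν
  by_cases hν : ν = μ
  · subst hν
    rw [hval, hxv, add_assoc, mul_comm, Nat.mul_add_div (by positivity), Nat.div_eq_of_lt ht, add_zero]
  · rw [runSite_apply_of_ne x hν]; exact hx ν

end Coord

/-! ## §3  Runs across a block face; the exact averaging weights on the two end blocks -/

section Runs

open B5Eq118OneStroke (iterBlock iterBlockOf mem_iterBlock mem_iterBlock_iff val_iterBlockOf)
open B6GlobalChartV1 (PV)
open B6AgreeQaQV1Chart (sitesPerDir_zero_eq_mul)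
open B6Ineq2142KLevelV1 (val_runSite_self runSite_apply_of_ne shift_apply_of_ne runSite_injOn)

variable {d ℓ m K : ℕ} {hd : 1 ≤ d + 1} {hL : Odd (ℓ + 1) ∧ 1 < ℓ + 1} {n : ℕ}

/-- the label of `y + e_μ` at any level: `(y_μ + 1) mod (sites per direction)`. [cite: Balaban1984PropagatorsI, (1.7) p.18, dictionary] -/
theorem val_shift_self' {P : Params} {j : ℕ} (y : Site P j) (μ : Fin P.d) [NeZero (P.sitesPerDir j)] :
    ((y.shift μ) μ).val = ((y μ).val + 1) % P.sitesPerDir j := by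
  simp only [Site.shift, Function.update_self]
  rw [ZMod.val_add, ZMod.val_one_eq_one_mod, Nat.add_mod_mod]

/-- two sites of one block with the same local coordinates coincide. [cite: Balaban1984PropagatorsI, (1.6) p.18, bookkeeping] -/
theorem eq_of_loc_eq (hn : n ≤ m + K) {y : Site (PV d ℓ m K hd hL) n} {x x' : Site (PV d ℓ m K hd hL) 0} (hx : x ∈ iterBlock n y)
    (hx' : x' ∈ iterBlock n y) (h : ∀ ν, loc n x ν = loc n x' ν) : x = x' := by
  rw [← ofLoc_loc hn hx, ← ofLoc_loc hn hx']
  congr 1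
  funext ν
  exact Fin.ext (h ν)

/-- **CROSSING THE FACE**: from the last slice (`loc_μ = L^n − 1`) one step in direction `μ` enters the block `B^n(y + e_μ)` at `loc_μ = 0`.
[cite: Balaban1984PropagatorsI, (1.6)–(1.7) p.18, bookkeeping] -/
theorem shift_mem_next (hn : n ≤ m + K) {y : Site (PV d ℓ m K hd hL) n} {x : Site (PV d ℓ m K hd hL) 0} (hx : x ∈ iterBlock n y)
    (μ : Fin (d + 1)) (hlast : loc n x μ = (ℓ + 1) ^ n - 1) :
    x.shift μ ∈ iterBlock n (y.shift μ) ∧ loc n (x.shift μ) μ = 0 ∧ ∀ ν, ν ≠ μ → loc n (x.shift μ) ν = loc n x ν := by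
  have hS : 0 < (ℓ + 1) ^ n := by positivity
  have hmul := sitesPerDir_zero_eq_mul (PV d ℓ m K hd hL) hn
  have hL' : (PV d ℓ m K hd hL).L = ℓ + 1 := rfl
  rw [hL'] at hmul
  haveI : NeZero ((PV d ℓ m K hd hL).sitesPerDir n) := ⟨(PV d ℓ m K hd hL).sitesPerDir_ne_zero n⟩
  have hxv := val_eq_of_mem hn hx μ
  -- the new `μ`-label: `((y_μ + 1)·S) mod (S·P_n) = S·((y_μ + 1) mod P_n)`
  have hval : ((x.shift μ) μ).val = (ℓ + 1) ^ n * (((y μ).val + 1) % (PV d ℓ m K hd hL).sitesPerDir n) := by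
    rw [B6Ineq2142KLevelV1.val_shift_self, hxv, hlast]
    have h1 : (y μ).val * (ℓ + 1) ^ n + ((ℓ + 1) ^ n - 1) + 1 = (ℓ + 1) ^ n * ((y μ).val + 1) := by
      zify [hS]; ring
    rw [h1]
    conv_lhs => rw [show (PV d ℓ m K hd hL).sitesPerDir 0 = (ℓ + 1) ^ n * (PV d ℓ m K hd hL).sitesPerDir n from hmul]
    rw [Nat.mul_mod_mul_left]
  have hother : ∀ ν, ν ≠ μ → loc n (x.shift μ) ν = loc n x ν := fun ν hν => by
    unfold loc; rw [shift_apply_of_ne x hν]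
  refine ⟨?_, ?_, hother⟩
  · rw [mem_iterBlock_iff hn] at hx ⊢
    intro ν
    by_cases hν : ν = μ
    · subst hν
      rw [hval, val_shift_self', Nat.mul_div_cancel_left _ hS]
    · rw [shift_apply_of_ne x hν, shift_apply_of_ne y hν]; exact hx ν
  · unfold loc; rw [hval, Nat.mul_mod_right]

/-- **A RUN ACROSS THE FACE**: if `L^n ≤ loc_μ x + t < 2L^n` then `x + te_μ ∈ B^n(y + e_μ)` with `loc_μ = loc_μ x + t − L^n`.
[cite: Balaban1984PropagatorsI, (1.7) p.18, bookkeeping] -/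
theorem runSite_mem_next (hn : n ≤ m + K) {y : Site (PV d ℓ m K hd hL) n} {x : Site (PV d ℓ m K hd hL) 0} (hx : x ∈ iterBlock n y)
    (μ : Fin (d + 1)) {t : ℕ} (hge : (ℓ + 1) ^ n ≤ loc n x μ + t) (ht : t < (ℓ + 1) ^ n) :
    runSite x μ t ∈ iterBlock n (y.shift μ) ∧ loc n (runSite x μ t) μ = loc n x μ + t - (ℓ + 1) ^ n ∧
      ∀ ν, ν ≠ μ → loc n (runSite x μ t) ν = loc n x ν := by
  set S := (ℓ + 1) ^ n with hSdef
  have hlx := loc_lt n x μ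
  -- reach the last slice, cross, continue
  set a := S - 1 - loc n x μ with ha
  have h1 := runSite_mem_of_loc hn hx μ (t := a) (by omega)
  have hlast : loc n (runSite x μ a) μ = S - 1 := by rw [h1.2.1]; omega
  have h2 := shift_mem_next hn h1.1 μ hlast
  have hx2 : runSite x μ (a + 1) ∈ iterBlock n (y.shift μ) := by rw [runSite_succ]; exact h2.1
  have hl2 : loc n (runSite x μ (a + 1)) μ = 0 := by rw [runSite_succ]; exact h2.2.1
  have h3 := runSite_mem_of_loc hn hx2 μ (t := t - (a + 1)) (by rw [hl2]; omega)
  have hsplit : runSite x μ t = runSite (runSite x μ (a + 1)) μ (t - (a + 1)) := by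
    rw [B5Eq118OneStroke.runSite_add]; congr 1; omega
  rw [hsplit]
  refine ⟨h3.1, ?_, fun ν hν => ?_⟩
  · rw [h3.2.1, hl2]; omega
  · rw [h3.2.2 ν hν, runSite_succ, h2.2.2 ν hν, h1.2.2 ν hν]

variable (hper : 2 ≤ (PV d ℓ m K hd hL).sitesPerDir n)
include hper

/-- with at least two blocks per direction, `y + e_μ ≠ y`. [cite: Balaban1984PropagatorsI, (1.7) p.18, bookkeeping] -/
theorem shift_ne_self (y : Site (PV d ℓ m K hd hL) n) (μ : Fin (d + 1)) : y.shift μ ≠ y := by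
  intro h
  have h1 := congrFun h μ
  simp only [Site.shift, Function.update_self] at h1
  have h2 : (1 : ZMod ((PV d ℓ m K hd hL).sitesPerDir n)) = 0 := by
    have := add_left_cancel (a := y μ) (b := 1) (c := 0) (by rw [add_zero]; exact h1)
    exact this
  haveI : Fact (1 < (PV d ℓ m K hd hL).sitesPerDir n) := ⟨by omega⟩
  exact one_ne_zero h2

omit hper in
/-- at most one step count `t < L^n ≤ N₀` reaches a given site. [cite: Balaban1984PropagatorsI, (1.7) p.18, bookkeeping] -/
theorem runSite_eq_unique (hn : n ≤ m + K) (x : Site (PV d ℓ m K hd hL) 0) (μ : Fin (d + 1)) {t t' : ℕ} (ht : t < (ℓ + 1) ^ n)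
    (ht' : t' < (ℓ + 1) ^ n) (h : runSite x μ t = runSite x μ t') : t = t' := by
  have hmul := sitesPerDir_zero_eq_mul (PV d ℓ m K hd hL) hn
  have hL' : (PV d ℓ m K hd hL).L = ℓ + 1 := rfl
  rw [hL'] at hmul
  have hSN : (ℓ + 1) ^ n ≤ (PV d ℓ m K hd hL).sitesPerDir 0 := by
    rw [hmul]; exact Nat.le_mul_of_pos_right _ (Nat.pos_of_ne_zero ((PV d ℓ m K hd hL).sitesPerDir_ne_zero n))
  exact runSite_injOn x μ (lt_of_lt_of_le ht hSN) (lt_of_lt_of_le ht' hSN) h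

/-- **REACHABILITY INSIDE THE SOURCE BLOCK**: for `x, z ∈ B^n(y)`, `z = x + te_μ` for some `t < L^n` iff `loc_μ x ≤ loc_μ z` and the other local
coordinates agree. [cite: Balaban1984PropagatorsI, (1.7)/(1.18) p.18–20, bookkeeping] -/
theorem reach_src_iff (hn : n ≤ m + K) {y : Site (PV d ℓ m K hd hL) n} {x z : Site (PV d ℓ m K hd hL) 0} (hx : x ∈ iterBlock n y)
    (hz : z ∈ iterBlock n y) (μ : Fin (d + 1)) :
    (∃ t < (ℓ + 1) ^ n, runSite x μ t = z) ↔ (loc n x μ ≤ loc n z μ ∧ ∀ ν, ν ≠ μ → loc n x ν = loc n z ν) := by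
  constructor
  · rintro ⟨t, ht, rfl⟩
    by_cases hlt : loc n x μ + t < (ℓ + 1) ^ n
    · have h := runSite_mem_of_loc hn hx μ hlt
      exact ⟨by rw [h.2.1]; omega, fun ν hν => (h.2.2 ν hν).symm⟩
    · exfalso
      have h := runSite_mem_next hn hx μ (not_lt.1 hlt) ht
      rw [mem_iterBlock] at hz
      have h' := h.1
      rw [mem_iterBlock, hz] at h'
      exact shift_ne_self hper y μ h'.symm
  · rintro ⟨hle, hoth⟩
    refine ⟨loc n z μ - loc n x μ, by have := loc_lt n z μ; omega, ?_⟩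
    have h := runSite_mem_of_loc hn hx μ (t := loc n z μ - loc n x μ) (by have := loc_lt n z μ; omega)
    refine eq_of_loc_eq hn h.1 hz fun ν => ?_
    by_cases hν : ν = μ
    · subst hν; rw [h.2.1]; omega
    · rw [h.2.2 ν hν, hoth ν hν]

/-- **REACHABILITY INTO THE TARGET BLOCK**: for `x ∈ B^n(y)`, `z ∈ B^n(y + e_μ)`, `z = x + te_μ` for some `t < L^n` iff `loc_μ z < loc_μ x` and the
other local coordinates agree. [cite: Balaban1984PropagatorsI, (1.7)/(1.18) p.18–20, bookkeeping] -/
theorem reach_tgt_iff (hn : n ≤ m + K) {y : Site (PV d ℓ m K hd hL) n} {x z : Site (PV d ℓ m K hd hL) 0} (hx : x ∈ iterBlock n y)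
    (μ : Fin (d + 1)) (hz : z ∈ iterBlock n (y.shift μ)) :
    (∃ t < (ℓ + 1) ^ n, runSite x μ t = z) ↔ (loc n z μ < loc n x μ ∧ ∀ ν, ν ≠ μ → loc n x ν = loc n z ν) := by
  constructor
  · rintro ⟨t, ht, rfl⟩
    by_cases hlt : loc n x μ + t < (ℓ + 1) ^ n
    · exfalso
      have h := runSite_mem_of_loc hn hx μ hlt
      have h1 := h.1
      rw [mem_iterBlock] at h1 hz
      rw [h1] at hz
      exact shift_ne_self hper y μ hz.symm
    · have h := runSite_mem_next hn hx μ (not_lt.1 hlt) ht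
      exact ⟨by rw [h.2.1]; omega, fun ν hν => (h.2.2 ν hν).symm⟩
  · rintro ⟨hlt, hoth⟩
    have hlx := loc_lt n x μ
    refine ⟨(ℓ + 1) ^ n + loc n z μ - loc n x μ, by omega, ?_⟩
    have h := runSite_mem_next hn hx μ (t := (ℓ + 1) ^ n + loc n z μ - loc n x μ) (by omega) (by omega)
    refine eq_of_loc_eq hn h.1 hz fun ν => ?_
    by_cases hν : ν = μ
    · subst hν; rw [h.2.1]; omega
    · rw [h.2.2 ν hν, hoth ν hν]

end Runs

/-! ## §3b  The exact averaging weights `q_i` on the source and target blocks -/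

section Weights

open B5Eq118OneStroke (iterBlock iterBlockOf mem_iterBlock mem_iterBlock_iff)
open B6MultiLevelBoxOperator (N0)
open B6MultiLevelTorusOperator (TDomains)
open B6GlobalChartV1 (PV domT)
open B6Ineq2142KLevelV1 (lvl lvl_le_mK cQ qwt qwt_eq_sum exists_of_qwt_ne_zero iterBlockOf_runSite_mem)

variable {d ℓ m K : ℕ} {hd : 1 ≤ d + 1} {hL : Odd (ℓ + 1) ∧ 1 < ℓ + 1}
variable {Mh k R : ℕ} {P' : Fin (d + 1) → ℕ}
variable (hN : ∀ μ, N0 ℓ Mh k P' μ = (PV d ℓ m K hd hL).sitesPerDir 0) (D : TDomains d ℓ Mh k P' R) (hk : k ≤ m + K)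

/-- `Σ_{s < S} [s ≤ a] = a + 1` (`a < S`). [cite: Balaban1984PropagatorsI, (1.18) p.20, bookkeeping] -/
theorem sum_fin_ite_le {S a : ℕ} (ha : a < S) : ∑ s : Fin S, (if (s : ℕ) ≤ a then (1 : ℝ) else 0) = a + 1 := by
  rw [Fin.sum_univ_eq_sum_range (f := fun s => if s ≤ a then (1 : ℝ) else 0), ← Finset.sum_filter]
  have h : (Finset.range S).filter (fun s => s ≤ a) = Finset.range (a + 1) := by
    ext s; simp only [Finset.mem_filter, Finset.mem_range]; omega
  rw [h, Finset.sum_const, Finset.card_range, nsmul_eq_mul, mul_one]; push_cast; ring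

/-- `Σ_{s < S} [a < s] = S − 1 − a` (`a < S`). [cite: Balaban1984PropagatorsI, (1.18) p.20, bookkeeping] -/
theorem sum_fin_ite_gt {S a : ℕ} (ha : a < S) : ∑ s : Fin S, (if a < (s : ℕ) then (1 : ℝ) else 0) = ((S - 1 - a : ℕ) : ℝ) := by
  rw [Fin.sum_univ_eq_sum_range (f := fun s => if a < s then (1 : ℝ) else 0), ← Finset.sum_filter]
  have h : (Finset.range S).filter (fun s => a < s) = Finset.Ico (a + 1) S := by
    ext s; simp only [Finset.mem_filter, Finset.mem_range, Finset.mem_Ico]; omega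
  rw [h, Finset.sum_const, Nat.card_Ico, nsmul_eq_mul, mul_one]; congr 1; omega

/-- `Σ_{s < S} [s = a] = 1` (`a < S`). [cite: Balaban1984PropagatorsI, (1.18) p.20, bookkeeping] -/
theorem sum_fin_ite_eq {S a : ℕ} (ha : a < S) : ∑ s : Fin S, (if (s : ℕ) = a then (1 : ℝ) else 0) = 1 := by
  rw [Fin.sum_univ_eq_sum_range (f := fun s => if s = a then (1 : ℝ) else 0), Finset.sum_ite_eq', if_pos (Finset.mem_range.2 ha)]

/-- the step count reaching a site is unique, so the inner sum is an indicator. [cite: Balaban1984PropagatorsI, (1.7) p.18, bookkeeping] -/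
theorem sum_range_ite_runSite {n : ℕ} (hn : n ≤ m + K) (x z : Site (PV d ℓ m K hd hL) 0) (μ : Fin (d + 1)) :
    ∑ t ∈ Finset.range ((ℓ + 1) ^ n), (if runSite x μ t = z then (1 : ℝ) else 0) =
      if (∃ t < (ℓ + 1) ^ n, runSite x μ t = z) then 1 else 0 := by
  classical
  split_ifs with h
  · obtain ⟨t₀, ht₀, hz⟩ := h
    have huniq : ∀ t ∈ Finset.range ((ℓ + 1) ^ n), (runSite x μ t = z ↔ t = t₀) := fun t ht =>
      ⟨fun h' => runSite_eq_unique hn x μ (Finset.mem_range.1 ht) ht₀ (h'.trans hz.symm), fun h' => h' ▸ hz⟩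
    rw [Finset.sum_congr rfl fun t ht => by rw [if_congr (huniq t ht) rfl rfl], Finset.sum_ite_eq', if_pos (Finset.mem_range.2 ht₀)]
  · exact Finset.sum_eq_zero fun t ht => if_neg fun h' => h ⟨t, Finset.mem_range.1 ht, h'⟩

/-- **THE PAIR COUNT IN THE SOURCE BLOCK**: `#{(x, t) ∈ B^n(y) × [0, L^n) : x + te_μ = z} = loc_μ z + 1` for `z ∈ B^n(y)`.
[cite: Balaban1984PropagatorsI, (1.18) p.20 (the multiplicity of a bond in `Q_k`), bookkeeping] -/
theorem pairCount_src {n : ℕ} (hn : n ≤ m + K) (hper : 2 ≤ (PV d ℓ m K hd hL).sitesPerDir n) {y : Site (PV d ℓ m K hd hL) n}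
    {z : Site (PV d ℓ m K hd hL) 0} (hz : z ∈ iterBlock n y) (μ : Fin (d + 1)) :
    ∑ x ∈ iterBlock n y, ∑ t ∈ Finset.range ((ℓ + 1) ^ n), (if runSite x μ t = z then (1 : ℝ) else 0) = (loc n z μ : ℝ) + 1 := by
  classical
  -- the indicator of reachability is a product of one-dimensional indicators
  set g : Fin (d + 1) → ℕ → ℝ := fun ν s => if ν = μ then (if s ≤ loc n z μ then 1 else 0) else (if s = loc n z ν then 1 else 0) with hg
  have hind : ∀ x ∈ iterBlock n y, (∑ t ∈ Finset.range ((ℓ + 1) ^ n), (if runSite x μ t = z then (1 : ℝ) else 0)) = ∏ ν, g ν (loc n x ν) := by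
    intro x hx
    rw [sum_range_ite_runSite hn, if_congr (reach_src_iff hper hn hx hz μ) rfl rfl]
    by_cases hc : loc n x μ ≤ loc n z μ ∧ ∀ ν, ν ≠ μ → loc n x ν = loc n z ν
    · rw [if_pos hc]; symm
      refine Finset.prod_eq_one fun ν _ => ?_
      by_cases hν : ν = μ
      · subst hν; simp only [hg, if_true, if_pos hc.1]
      · simp only [hg, if_neg hν, if_pos (hc.2 ν hν)]
    · rw [if_neg hc]; symm
      by_cases h1 : loc n x μ ≤ loc n z μ
      · have h2 : ∃ ν, ν ≠ μ ∧ loc n x ν ≠ loc n z ν := by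
          by_contra h3
          exact hc ⟨h1, fun ν hν => by by_contra hne; exact h3 ⟨ν, hν, hne⟩⟩
        obtain ⟨ν, hν, hne⟩ := h2
        exact Finset.prod_eq_zero (Finset.mem_univ ν) (by simp only [hg, if_neg hν, if_neg hne])
      · exact Finset.prod_eq_zero (Finset.mem_univ μ) (by simp only [hg, if_true, if_neg h1])
  rw [Finset.sum_congr rfl hind, sum_block_prod hn, Finset.prod_eq_single μ (fun ν _ hν => ?_) (fun h => absurd (Finset.mem_univ μ) h)]
  · simp only [hg, if_true]
    exact sum_fin_ite_le (loc_lt n z μ)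
  · simp only [hg, if_neg hν]
    exact sum_fin_ite_eq (loc_lt n z ν)

/-- **THE PAIR COUNT IN THE TARGET BLOCK**: `#{(x, t) ∈ B^n(y) × [0, L^n) : x + te_μ = z} = L^n − 1 − loc_μ z` for `z ∈ B^n(y + e_μ)`.
[cite: Balaban1984PropagatorsI, (1.18) p.20, bookkeeping] -/
theorem pairCount_tgt {n : ℕ} (hn : n ≤ m + K) (hper : 2 ≤ (PV d ℓ m K hd hL).sitesPerDir n) {y : Site (PV d ℓ m K hd hL) n} (μ : Fin (d + 1))
    {z : Site (PV d ℓ m K hd hL) 0} (hz : z ∈ iterBlock n (y.shift μ)) :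
    ∑ x ∈ iterBlock n y, ∑ t ∈ Finset.range ((ℓ + 1) ^ n), (if runSite x μ t = z then (1 : ℝ) else 0) =
      (((ℓ + 1) ^ n - 1 - loc n z μ : ℕ) : ℝ) := by
  classical
  set g : Fin (d + 1) → ℕ → ℝ := fun ν s => if ν = μ then (if loc n z μ < s then 1 else 0) else (if s = loc n z ν then 1 else 0) with hg
  have hind : ∀ x ∈ iterBlock n y, (∑ t ∈ Finset.range ((ℓ + 1) ^ n), (if runSite x μ t = z then (1 : ℝ) else 0)) = ∏ ν, g ν (loc n x ν) := by
    intro x hx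
    rw [sum_range_ite_runSite hn, if_congr (reach_tgt_iff hper hn hx μ hz) rfl rfl]
    by_cases hc : loc n z μ < loc n x μ ∧ ∀ ν, ν ≠ μ → loc n x ν = loc n z ν
    · rw [if_pos hc]; symm
      refine Finset.prod_eq_one fun ν _ => ?_
      by_cases hν : ν = μ
      · subst hν; simp only [hg, if_true, if_pos hc.1]
      · simp only [hg, if_neg hν, if_pos (hc.2 ν hν)]
    · rw [if_neg hc]; symm
      by_cases h1 : loc n z μ < loc n x μ
      · have h2 : ∃ ν, ν ≠ μ ∧ loc n x ν ≠ loc n z ν := by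
          by_contra h3
          exact hc ⟨h1, fun ν hν => by by_contra hne; exact h3 ⟨ν, hν, hne⟩⟩
        obtain ⟨ν, hν, hne⟩ := h2
        exact Finset.prod_eq_zero (Finset.mem_univ ν) (by simp only [hg, if_neg hν, if_neg hne])
      · exact Finset.prod_eq_zero (Finset.mem_univ μ) (by simp only [hg, if_true, if_neg h1])
  rw [Finset.sum_congr rfl hind, sum_block_prod hn, Finset.prod_eq_single μ (fun ν _ hν => ?_) (fun h => absurd (Finset.mem_univ μ) h)]
  · simp only [hg, if_true]
    exact sum_fin_ite_gt (loc_lt n z μ)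
  · simp only [hg, if_neg hν]
    exact sum_fin_ite_eq (loc_lt n z ν)

/-- **`q_i` ON THE SOURCE BLOCK**: `q_i(⟨z, μ_i⟩) = c_Q·(loc_μ z + 1)` for `z ∈ B^j(b₋)` — the increasing tent toward the face shared with `B^j(b₊)`.
[cite: Balaban1984PropagatorsI, (1.18) p.20; Balaban1984PropagatorsII, (2.20) p.226] -/
theorem qwt_src (i : BondIdx (domT hN D hk)) (hper : 2 ≤ (PV d ℓ m K hd hL).sitesPerDir (lvl hN D hk i)) {z : Site (PV d ℓ m K hd hL) 0}
    (hz : z ∈ iterBlock (lvl hN D hk i) i.1.2.src) :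
    qwt hN D hk i ⟨z, i.1.2.dir⟩ = cQ (d := d) (ℓ := ℓ) (lvl hN D hk i) * ((loc (lvl hN D hk i) z i.1.2.dir : ℝ) + 1) := by
  classical
  rw [qwt_eq_sum, ← pairCount_src (lvl_le_mK hN D hk i) hper hz i.1.2.dir]
  congr 1
  refine Finset.sum_congr rfl fun x _ => Finset.sum_congr rfl fun t _ => ?_
  exact if_congr (by simp [runBond, PBond.mk.injEq]) rfl rfl

/-- **`q_i` ON THE TARGET BLOCK**: `q_i(⟨z, μ_i⟩) = c_Q·(L^j − 1 − loc_μ z)` for `z ∈ B^j(b₊)` — the decreasing tent.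
[cite: Balaban1984PropagatorsI, (1.18) p.20; Balaban1984PropagatorsII, (2.20) p.226] -/
theorem qwt_tgt (i : BondIdx (domT hN D hk)) (hper : 2 ≤ (PV d ℓ m K hd hL).sitesPerDir (lvl hN D hk i)) {z : Site (PV d ℓ m K hd hL) 0}
    (hz : z ∈ iterBlock (lvl hN D hk i) i.1.2.tgt) :
    qwt hN D hk i ⟨z, i.1.2.dir⟩ = cQ (d := d) (ℓ := ℓ) (lvl hN D hk i) * ((((ℓ + 1) ^ (lvl hN D hk i) - 1 - loc (lvl hN D hk i) z i.1.2.dir : ℕ) : ℝ)) := by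
  classical
  have hz' : z ∈ iterBlock (lvl hN D hk i) (i.1.2.src.shift i.1.2.dir) := hz
  rw [qwt_eq_sum, ← pairCount_tgt (lvl_le_mK hN D hk i) hper i.1.2.dir hz']
  congr 1
  refine Finset.sum_congr rfl fun x _ => Finset.sum_congr rfl fun t _ => ?_
  exact if_congr (by simp [runBond, PBond.mk.injEq]) rfl rfl

/-- **`q_i` VANISHES ON BONDS OF OTHER DIRECTIONS.** [cite: Balaban1984PropagatorsI, (1.18) p.20] -/
theorem qwt_eq_zero_of_dir_ne (i : BondIdx (domT hN D hk)) {f : PBond (PV d ℓ m K hd hL) 0} (hf : f.dir ≠ i.1.2.dir) :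
    qwt hN D hk i f = 0 := by
  by_contra h
  obtain ⟨x, -, t, -, hxt⟩ := exists_of_qwt_ne_zero hN D hk i h
  exact hf (by rw [← hxt]; rfl)

/-- **`q_i` VANISHES OFF THE DOUBLE BLOCK `B^j(b₋) ∪ B^j(b₊)`.** [cite: Balaban1984PropagatorsI, (1.18) p.20] -/
theorem qwt_eq_zero_of_not_mem (i : BondIdx (domT hN D hk)) {f : PBond (PV d ℓ m K hd hL) 0}
    (h1 : f.src ∉ iterBlock (lvl hN D hk i) i.1.2.src) (h2 : f.src ∉ iterBlock (lvl hN D hk i) i.1.2.tgt) : qwt hN D hk i f = 0 := by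
  by_contra h
  obtain ⟨x, hx, t, ht, hxt⟩ := exists_of_qwt_ne_zero hN D hk i h
  rw [mem_iterBlock] at hx
  have hsrc : f.src = runSite x i.1.2.dir t := by rw [← hxt]; rfl
  rcases iterBlockOf_runSite_mem (lvl_le_mK hN D hk i) x i.1.2.dir ht.le with h' | h'
  · exact h1 (by rw [mem_iterBlock, hsrc, h', hx])
  · exact h2 (by rw [mem_iterBlock, hsrc, h', hx]; rfl)

end Weights

/-! ## §4  The test bumps `φ_i` and their exact pairings with the averaging weights -/

section Bumps

open B5Eq118OneStroke (iterBlock iterBlockOf mem_iterBlock mem_iterBlock_iff)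
open B6MultiLevelBoxOperator (N0)
open B6MultiLevelTorusOperator (TDomains)
open B6GlobalChartV1 (PV domT)
open B6SectAOperatorsV1 (inner_eq_sum)
open B6Ineq2142KLevelV1 (lvl lvl_le_mK one_le_lvl base base_mem ends_eq cQ cQ_pos qwt qwt_eq_sum QsE_single_apply)

variable {d ℓ m K : ℕ} {hd : 1 ≤ d + 1} {hL : Odd (ℓ + 1) ∧ 1 < ℓ + 1}
variable {Mh k R : ℕ} {P' : Fin (d + 1) → ℕ}
variable (hN : ∀ μ, N0 ℓ Mh k P' μ = (PV d ℓ m K hd hL).sitesPerDir 0) (D : TDomains d ℓ Mh k P' R) (hk : k ≤ m + K)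

/-- **THE ONE-DIMENSIONAL TENT SUMS.** The first moment of a symmetric integer tent about its centre vanishes:
`Σ_{u<S} (u − c)·(r − |u − c|)⁺ = 0` when the support fits (`r ≤ c + 1`, `c + r ≤ S`). [cite: Balaban1984PropagatorsII, (2.147) p.248 (the test functions), bookkeeping] -/
theorem sum_moment_tent {S c r : ℕ} (h1 : r ≤ c + 1) (h2 : c + r ≤ S) :
    ∑ u : Fin S, ((u : ℝ) - c) * max 0 ((r : ℝ) - |(u : ℝ) - c|) = 0 := by
  classical
  refine Finset.sum_involution (fun u _ => if h : (u : ℕ) ≤ 2 * c ∧ 2 * c - (u : ℕ) < S then ⟨2 * c - u, h.2⟩ else u) ?_ ?_ ?_ ?_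
  · intro u _
    by_cases h : (u : ℕ) ≤ 2 * c ∧ 2 * c - (u : ℕ) < S
    · rw [dif_pos h]
      have hc : (((2 * c - (u : ℕ) : ℕ) : ℝ)) = 2 * c - u := by
        rw [Nat.cast_sub h.1]; push_cast; ring
      simp only [hc]
      have : |2 * (c : ℝ) - u - c| = |(u : ℝ) - c| := by
        rw [show 2 * (c : ℝ) - u - c = -((u : ℝ) - c) by ring, abs_neg]
      rw [this]; ring
    · rw [dif_neg h]
      -- off the window the tent vanishes
      have hz : max 0 ((r : ℝ) - |(u : ℝ) - c|) = 0 := by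
        refine max_eq_left ?_
        rw [sub_nonpos]
        rw [not_and_or, not_le, not_lt] at h
        rcases h with h | h
        · have : (r : ℝ) ≤ (u : ℝ) - c := by
            have : c + r ≤ (u : ℕ) := by omega
            have := (Nat.cast_le (α := ℝ)).2 this; push_cast at this; linarith
          exact this.trans (le_abs_self _)
        · have hu : (u : ℕ) < S := u.2
          have : (r : ℝ) ≤ (c : ℝ) - u := by
            have : (u : ℕ) + r ≤ c := by omega
            have := (Nat.cast_le (α := ℝ)).2 this; push_cast at this; linarith
          exact this.trans ((neg_sub (u : ℝ) c) ▸ neg_le_abs _)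
      simp only [hz, mul_zero, add_zero]
  · intro u _ hne
    by_cases h : (u : ℕ) ≤ 2 * c ∧ 2 * c - (u : ℕ) < S
    · rw [dif_pos h]
      intro heq
      have hv := congrArg Fin.val heq
      simp only at hv
      have huc : (u : ℕ) = c := by omega
      apply hne
      rw [huc, sub_self, zero_mul]
    · exfalso
      apply hne
      -- as above, the tent vanishes off the window
      have hz : max 0 ((r : ℝ) - |(u : ℝ) - c|) = 0 := by
        refine max_eq_left ?_
        rw [sub_nonpos]
        rw [not_and_or, not_le, not_lt] at h
        rcases h with h | h
        · have : (r : ℝ) ≤ (u : ℝ) - c := by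
            have : c + r ≤ (u : ℕ) := by omega
            have := (Nat.cast_le (α := ℝ)).2 this; push_cast at this; linarith
          exact this.trans (le_abs_self _)
        · have hu : (u : ℕ) < S := u.2
          have : (r : ℝ) ≤ (c : ℝ) - u := by
            have : (u : ℕ) + r ≤ c := by omega
            have := (Nat.cast_le (α := ℝ)).2 this; push_cast at this; linarith
          exact this.trans ((neg_sub (u : ℝ) c) ▸ neg_le_abs _)
      rw [hz, mul_zero]
  · intro u _; exact Finset.mem_univ _
  · intro u _
    by_cases h : (u : ℕ) ≤ 2 * c ∧ 2 * c - (u : ℕ) < S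
    · rw [dif_pos h]
      have h' : ((2 * c - (u : ℕ) : ℕ)) ≤ 2 * c ∧ 2 * c - (2 * c - (u : ℕ)) < S := ⟨Nat.sub_le _ _, by have := u.2; omega⟩
      rw [dif_pos h']
      exact Fin.ext (by simp only; omega)
    · rw [dif_neg h, dif_neg h]

/-- **AN AFFINE WEIGHT AGAINST A SYMMETRIC TENT**: `Σ_{u<S} (α + βu)·τ(u) = (α + βc)·Σ_{u<S} τ(u)`. [cite: Balaban1984PropagatorsII, (2.147) p.248, bookkeeping] -/
theorem sum_affine_tent {S c r : ℕ} (h1 : r ≤ c + 1) (h2 : c + r ≤ S) (α β : ℝ) :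
    ∑ u : Fin S, (α + β * u) * max 0 ((r : ℝ) - |(u : ℝ) - c|) = (α + β * c) * ∑ u : Fin S, max 0 ((r : ℝ) - |(u : ℝ) - c|) := by
  have h0 := sum_moment_tent h1 h2
  have h3 : ∑ u : Fin S, (α + β * u) * max 0 ((r : ℝ) - |(u : ℝ) - c|) -
      (α + β * c) * ∑ u : Fin S, max 0 ((r : ℝ) - |(u : ℝ) - c|) = β * ∑ u : Fin S, ((u : ℝ) - c) * max 0 ((r : ℝ) - |(u : ℝ) - c|) := by
    rw [Finset.mul_sum, Finset.mul_sum, ← Finset.sum_sub_distrib]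
    exact Finset.sum_congr rfl fun u _ => by ring
  rw [h0, mul_zero, sub_eq_zero] at h3
  exact h3

/-- the radius `r = ⌊L^j/5⌋` of the longitudinal tent. [cite: Balaban1984PropagatorsII, (2.147) p.248, bookkeeping ours] -/
def rad (i : BondIdx (domT hN D hk)) : ℕ := (ℓ + 1) ^ (lvl hN D hk i) / 5

/-- `1 ≤ r` for `L ≥ 5`, `j ≥ 1`. [cite: Balaban1984PropagatorsII, (2.147) p.248, bookkeeping] -/
theorem one_le_rad (hk1 : 1 ≤ k) (hℓ : 4 ≤ ℓ) (i : BondIdx (domT hN D hk)) : 1 ≤ rad hN D hk i := by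
  unfold rad
  have hj := one_le_lvl hN D hk hk1 i
  have h5 : 5 ≤ (ℓ + 1) ^ (lvl hN D hk i) :=
    le_trans (by rw [pow_one]; omega : 5 ≤ (ℓ + 1) ^ 1) (Nat.pow_le_pow_right (by omega) hj)
  exact (Nat.le_div_iff_mul_le (by norm_num)).2 (by omega)

/-- `5r ≤ L^j`. [cite: Balaban1984PropagatorsII, (2.147) p.248, bookkeeping] -/
theorem five_mul_rad_le (i : BondIdx (domT hN D hk)) : 5 * rad hN D hk i ≤ (ℓ + 1) ^ (lvl hN D hk i) := by
  unfold rad; rw [mul_comm]; exact Nat.div_mul_le_self _ _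

/-- the centre of the longitudinal tent: `L^j − 1 − r` next to the face shared with `B(b₊)` when the base block is the source block
(case A), `r − 1` next to the face shared with `B(b₋)` when it is the target block (case B). [cite: Balaban1984PropagatorsII, (2.147) p.248, bookkeeping ours] -/
def ctr (i : BondIdx (domT hN D hk)) : ℕ :=
  if i.1.2.src ∈ (domT hN D hk).Om (lvl hN D hk i) then (ℓ + 1) ^ (lvl hN D hk i) - 1 - rad hN D hk i else rad hN D hk i - 1

/-- the longitudinal tent `τ(u) = (r − |u − c|)⁺`. [cite: Balaban1984PropagatorsII, (2.147) p.248, bookkeeping ours] -/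
def tauL (i : BondIdx (domT hN D hk)) (u : ℕ) : ℝ := max 0 ((rad hN D hk i : ℝ) - |(u : ℝ) - ctr hN D hk i|)

/-- the transverse tent `τ_⊥(c) = min(c + 1, L^j − c)`. [cite: Balaban1984PropagatorsII, (2.147) p.248, bookkeeping ours] -/
def tauT (j : ℕ) (c : ℕ) : ℝ := min ((c : ℝ) + 1) ((((ℓ + 1) ^ j : ℕ) : ℝ) - c)

/-- `τ ≥ 0`. [cite: Balaban1984PropagatorsII, (2.147) p.248, bookkeeping] -/
theorem tauL_nonneg (i : BondIdx (domT hN D hk)) (u : ℕ) : 0 ≤ tauL hN D hk i u := le_max_left _ _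

/-- `τ_⊥ ≥ 1 > 0` on `[0, L^j)`. [cite: Balaban1984PropagatorsII, (2.147) p.248, bookkeeping] -/
theorem one_le_tauT {j c : ℕ} (hc : c < (ℓ + 1) ^ j) : 1 ≤ tauT (ℓ := ℓ) j c := by
  unfold tauT
  refine le_min (by linarith [(Nat.cast_nonneg c : (0 : ℝ) ≤ c)]) ?_
  have : (c : ℝ) + 1 ≤ (((ℓ + 1) ^ j : ℕ) : ℝ) := by exact_mod_cast hc
  linarith

/-- **THE BUMP `φ_i`**: supported on the `μ_i`-bonds issuing from the base block `B^j(base i)`, product of the longitudinal and transverse tents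
in block-local coordinates. [cite: Balaban1984PropagatorsII, (2.147) p.248 (test functions for the lower bound), bookkeeping ours] -/
def bumpFn (i : BondIdx (domT hN D hk)) : PBond (PV d ℓ m K hd hL) 0 → ℝ := fun f =>
  if f.dir = i.1.2.dir ∧ f.src ∈ iterBlock (lvl hN D hk i) (base hN D hk i) then
    tauL hN D hk i (loc (lvl hN D hk i) f.src i.1.2.dir) *
      ∏ ν ∈ Finset.univ.erase i.1.2.dir, tauT (ℓ := ℓ) (lvl hN D hk i) (loc (lvl hN D hk i) f.src ν)
  else 0

/-- `φ_i` as an element of `L²(bonds)`. [cite: Balaban1984PropagatorsII, (2.147) p.248] -/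
def bump (i : BondIdx (domT hN D hk)) : BondSpace (PV d ℓ m K hd hL) := WithLp.toLp 2 (bumpFn hN D hk i)

/-- `φ_i ≥ 0`. [cite: Balaban1984PropagatorsII, (2.147) p.248, bookkeeping] -/
theorem bumpFn_nonneg (i : BondIdx (domT hN D hk)) (f : PBond (PV d ℓ m K hd hL) 0) : 0 ≤ bumpFn hN D hk i f := by
  unfold bumpFn
  split_ifs with h
  · refine mul_nonneg (tauL_nonneg hN D hk i _) (Finset.prod_nonneg fun ν _ => ?_)
    exact zero_le_one.trans (one_le_tauT (loc_lt _ _ _))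
  · exact le_rfl

/-- **THE PAIRING FORMULA**: `(Qφ)_{i′} = Σ_f q_{i′}(f)·φ(f)`. [cite: Balaban1984PropagatorsII, (2.20) p.226; Balaban1984PropagatorsI, (1.18) p.20] -/
theorem QE_apply_eq_sum_qwt (i' : BondIdx (domT hN D hk)) (v : BondSpace (PV d ℓ m K hd hL)) :
    QE (domT hN D hk) v i' = ∑ f, qwt hN D hk i' f * v f := by
  have h : QE (domT hN D hk) v i' = ⟪EuclideanSpace.single i' (1 : ℝ), QE (domT hN D hk) v⟫_ℝ := by
    rw [EuclideanSpace.inner_single_left]; simp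
  rw [h, ← inner_QsE_left, inner_eq_sum]
  exact Finset.sum_congr rfl fun f _ => by rw [QsE_single_apply]

end Bumps

/-! ## §4b  The exact pairings: mass, partner, coarse bound, vanishing -/

section Pairings

open B5Eq118OneStroke (iterBlock iterBlockOf mem_iterBlock mem_iterBlock_iff)
open B6MultiLevelBoxOperator (N0)
open B6MultiLevelTorusOperator (TDomains)
open B6GlobalChartV1 (PV domT)
open B6Ineq2142KLevelV1 (lvl lvl_le_mK one_le_lvl base cQ cQ_pos qwt qwt_nonneg qwt_le)

variable {d ℓ m K : ℕ} {hd : 1 ≤ d + 1} {hL : Odd (ℓ + 1) ∧ 1 < ℓ + 1}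
variable {Mh k R : ℕ} {P' : Fin (d + 1) → ℕ}
variable (hN : ∀ μ, N0 ℓ Mh k P' μ = (PV d ℓ m K hd hL).sitesPerDir 0) (D : TDomains d ℓ Mh k P' R) (hk : k ≤ m + K)

/-- the longitudinal tent mass `Σ_u τ(u)`. [cite: Balaban1984PropagatorsII, (2.147) p.248, bookkeeping] -/
def tsumL (i : BondIdx (domT hN D hk)) : ℝ := ∑ t : Fin ((ℓ + 1) ^ (lvl hN D hk i)), tauL hN D hk i t

/-- the transverse tent mass `Σ_c τ_⊥(c)`. [cite: Balaban1984PropagatorsII, (2.147) p.248, bookkeeping] -/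
def Tsum (j : ℕ) : ℝ := ∑ t : Fin ((ℓ + 1) ^ j), tauT (ℓ := ℓ) j t

/-- **A PAIRING AGAINST A WEIGHT SUPPORTED ON THE BASE BLOCK**: if `q_{i′}(⟨z, μ_i⟩) = c·a(loc_μ z)` on `B^j(base i)` then
`(Qφ_i)_{i′} = c·(Σ_u a(u)τ(u))·(Στ_⊥)^d` (Fubini on the block). [cite: Balaban1984PropagatorsI, (1.18) p.20; Balaban1984PropagatorsII, (2.147) p.248, bookkeeping] -/
theorem pair_eq_of_weight (i i' : BondIdx (domT hN D hk)) {c : ℝ} {a : ℕ → ℝ}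
    (hq : ∀ z ∈ iterBlock (lvl hN D hk i) (base hN D hk i), qwt hN D hk i' ⟨z, i.1.2.dir⟩ = c * a (loc (lvl hN D hk i) z i.1.2.dir)) :
    QE (domT hN D hk) (bump hN D hk i) i' =
      c * (∑ t : Fin ((ℓ + 1) ^ (lvl hN D hk i)), a t * tauL hN D hk i t) * Tsum (ℓ := ℓ) (lvl hN D hk i) ^ d := by
  classical
  set j := lvl hN D hk i
  set μ := i.1.2.dir
  rw [QE_apply_eq_sum_qwt, B10StarCount.sum_pbond]
  -- collapse the direction sum and restrict to the base block
  have h1 : ∀ z : Site (PV d ℓ m K hd hL) 0, (∑ ν : Fin (d + 1), qwt hN D hk i' ⟨z, ν⟩ * bump hN D hk i ⟨z, ν⟩) =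
      if z ∈ iterBlock j (base hN D hk i) then
        c * (a (loc j z μ) * tauL hN D hk i (loc j z μ)) * ∏ ν ∈ Finset.univ.erase μ, tauT (ℓ := ℓ) j (loc j z ν) else 0 := by
    intro z
    have hb : ∀ ν, bump hN D hk i ⟨z, ν⟩ = if ν = μ ∧ z ∈ iterBlock j (base hN D hk i) then
        tauL hN D hk i (loc j z μ) * ∏ ν ∈ Finset.univ.erase μ, tauT (ℓ := ℓ) j (loc j z ν) else 0 := fun ν => rfl
    simp_rw [hb]
    by_cases hz : z ∈ iterBlock j (base hN D hk i)
    · rw [if_pos hz]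
      rw [Finset.sum_eq_single μ (fun ν _ hν => by rw [if_neg (fun h => hν h.1), mul_zero]) (fun h => absurd (Finset.mem_univ μ) h),
        if_pos ⟨rfl, hz⟩, hq z hz]
      ring
    · rw [if_neg hz]
      exact Finset.sum_eq_zero fun ν _ => by rw [if_neg (fun h => hz h.2), mul_zero]
  rw [Finset.sum_congr rfl fun z _ => h1 z, ← Finset.sum_filter, Finset.filter_mem_eq_inter, Finset.univ_inter]
  -- Fubini
  set g : Fin (d + 1) → ℕ → ℝ := fun ν u => if ν = μ then c * (a u * tauL hN D hk i u) else tauT (ℓ := ℓ) j u with hg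
  have h2 : ∀ z ∈ iterBlock j (base hN D hk i),
      c * (a (loc j z μ) * tauL hN D hk i (loc j z μ)) * ∏ ν ∈ Finset.univ.erase μ, tauT (ℓ := ℓ) j (loc j z ν) = ∏ ν, g ν (loc j z ν) := by
    intro z _
    rw [← Finset.mul_prod_erase Finset.univ (fun ν => g ν (loc j z ν)) (Finset.mem_univ μ)]
    simp only [hg, if_true]
    congr 1
    exact Finset.prod_congr rfl fun ν hν => by rw [if_neg (Finset.ne_of_mem_erase hν)]
  rw [Finset.sum_congr rfl h2, sum_block_prod (lvl_le_mK hN D hk i),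
    ← Finset.mul_prod_erase Finset.univ (fun ν => ∑ t : Fin ((ℓ + 1) ^ j), g ν t) (Finset.mem_univ μ)]
  simp only [hg, if_true]
  rw [← Finset.mul_sum, Finset.prod_congr rfl fun ν hν => by rw [show (∑ t : Fin ((ℓ + 1) ^ j), if ν = μ then c * (a t * tauL hN D hk i t)
      else tauT (ℓ := ℓ) j t) = Tsum (ℓ := ℓ) j from Finset.sum_congr rfl fun t _ => by rw [if_neg (Finset.ne_of_mem_erase hν)]],
    Finset.prod_const, Finset.card_erase_of_mem (Finset.mem_univ μ), Finset.card_univ, Fintype.card_fin]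
  rfl

/-- the tents fit inside the block: `r ≤ ctr + 1` and `ctr + r ≤ L^j`. [cite: Balaban1984PropagatorsII, (2.147) p.248, bookkeeping] -/
theorem ctr_fit (i : BondIdx (domT hN D hk)) :
    rad hN D hk i ≤ ctr hN D hk i + 1 ∧ ctr hN D hk i + rad hN D hk i ≤ (ℓ + 1) ^ (lvl hN D hk i) := by
  have h5 := five_mul_rad_le hN D hk i
  unfold ctr
  split_ifs <;> omega

/-- **THE SOURCE-TYPE PAIRING**: if `B^j(src i′) = B^j(base i)` (same level, same direction) then `(Qφ_i)_{i′} = c_Q·(ctr + 1)·Στ·(Στ_⊥)^d`.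
[cite: Balaban1984PropagatorsII, (2.147) p.248; Balaban1984PropagatorsI, (1.18) p.20] -/
theorem pair_src (i i' : BondIdx (domT hN D hk)) (hper : 2 ≤ (PV d ℓ m K hd hL).sitesPerDir (lvl hN D hk i'))
    (hj : lvl hN D hk i' = lvl hN D hk i) (hdir : i'.1.2.dir = i.1.2.dir)
    (hblk : iterBlock (lvl hN D hk i') i'.1.2.src = iterBlock (lvl hN D hk i) (base hN D hk i)) :
    QE (domT hN D hk) (bump hN D hk i) i' =
      cQ (d := d) (ℓ := ℓ) (lvl hN D hk i) * ((ctr hN D hk i : ℝ) + 1) * tsumL hN D hk i * Tsum (ℓ := ℓ) (lvl hN D hk i) ^ d := by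
  have hq : ∀ z ∈ iterBlock (lvl hN D hk i) (base hN D hk i), qwt hN D hk i' ⟨z, i.1.2.dir⟩ =
      cQ (d := d) (ℓ := ℓ) (lvl hN D hk i) * (fun u : ℕ => (u : ℝ) + 1) (loc (lvl hN D hk i) z i.1.2.dir) := by
    intro z hz
    rw [← hblk] at hz
    have h := qwt_src hN D hk i' hper hz
    rw [hdir, hj] at h
    exact h
  rw [pair_eq_of_weight hN D hk i i' (a := fun u : ℕ => (u : ℝ) + 1) hq]
  have hfit := ctr_fit hN D hk i
  have haff := sum_affine_tent (S := (ℓ + 1) ^ (lvl hN D hk i)) hfit.1 hfit.2 1 1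
  simp only [one_mul] at haff
  unfold tsumL tauL
  rw [show (∑ t : Fin ((ℓ + 1) ^ (lvl hN D hk i)), ((t : ℝ) + 1) * max 0 ((rad hN D hk i : ℝ) - |(t : ℝ) - ctr hN D hk i|)) =
      ((ctr hN D hk i : ℝ) + 1) * ∑ t : Fin ((ℓ + 1) ^ (lvl hN D hk i)), max 0 ((rad hN D hk i : ℝ) - |(t : ℝ) - ctr hN D hk i|) by
    rw [add_comm (ctr hN D hk i : ℝ) 1, ← haff]; exact Finset.sum_congr rfl fun t _ => by ring]
  ring

/-- **THE TARGET-TYPE PAIRING**: if `B^j(tgt i′) = B^j(base i)` (same level, same direction) then `(Qφ_i)_{i′} = c_Q·(L^j − 1 − ctr)·Στ·(Στ_⊥)^d`.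
[cite: Balaban1984PropagatorsII, (2.147) p.248; Balaban1984PropagatorsI, (1.18) p.20] -/
theorem pair_tgt (i i' : BondIdx (domT hN D hk)) (hper : 2 ≤ (PV d ℓ m K hd hL).sitesPerDir (lvl hN D hk i'))
    (hj : lvl hN D hk i' = lvl hN D hk i) (hdir : i'.1.2.dir = i.1.2.dir)
    (hblk : iterBlock (lvl hN D hk i') i'.1.2.tgt = iterBlock (lvl hN D hk i) (base hN D hk i)) :
    QE (domT hN D hk) (bump hN D hk i) i' =
      cQ (d := d) (ℓ := ℓ) (lvl hN D hk i) * ((((ℓ + 1) ^ (lvl hN D hk i) : ℕ) : ℝ) - 1 - ctr hN D hk i) * tsumL hN D hk i *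
        Tsum (ℓ := ℓ) (lvl hN D hk i) ^ d := by
  have hq : ∀ z ∈ iterBlock (lvl hN D hk i) (base hN D hk i), qwt hN D hk i' ⟨z, i.1.2.dir⟩ =
      cQ (d := d) (ℓ := ℓ) (lvl hN D hk i) * (fun u : ℕ => (((ℓ + 1) ^ (lvl hN D hk i) : ℕ) : ℝ) - 1 - u) (loc (lvl hN D hk i) z i.1.2.dir) := by
    intro z hz
    rw [← hblk] at hz
    have h := qwt_tgt hN D hk i' hper hz
    rw [hdir, hj] at h
    rw [h]
    simp only
    have hlt := loc_lt (lvl hN D hk i) z i.1.2.dir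
    rw [Nat.cast_sub (by omega), Nat.cast_sub (Nat.one_le_pow _ _ (by omega))]
    push_cast; ring
  rw [pair_eq_of_weight hN D hk i i' (a := fun u : ℕ => (((ℓ + 1) ^ (lvl hN D hk i) : ℕ) : ℝ) - 1 - u) hq]
  have hfit := ctr_fit hN D hk i
  have haff := sum_affine_tent (S := (ℓ + 1) ^ (lvl hN D hk i)) hfit.1 hfit.2 ((((ℓ + 1) ^ (lvl hN D hk i) : ℕ) : ℝ) - 1) (-1)
  unfold tsumL tauL
  rw [show (∑ t : Fin ((ℓ + 1) ^ (lvl hN D hk i)), ((((ℓ + 1) ^ (lvl hN D hk i) : ℕ) : ℝ) - 1 - t) *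
      max 0 ((rad hN D hk i : ℝ) - |(t : ℝ) - ctr hN D hk i|)) =
      ((((ℓ + 1) ^ (lvl hN D hk i) : ℕ) : ℝ) - 1 - ctr hN D hk i) * ∑ t : Fin ((ℓ + 1) ^ (lvl hN D hk i)), max 0 ((rad hN D hk i : ℝ) - |(t : ℝ) - ctr hN D hk i|) by
    have : ∀ t : Fin ((ℓ + 1) ^ (lvl hN D hk i)), ((((ℓ + 1) ^ (lvl hN D hk i) : ℕ) : ℝ) - 1 - t) =
        ((((ℓ + 1) ^ (lvl hN D hk i) : ℕ) : ℝ) - 1) + (-1) * t := fun t => by ring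
    simp_rw [this]
    rw [haff]; ring]
  ring

/-- **THE COARSE (AND EVERY) PAIRING IS BOUNDED BY THE SUP OF THE WEIGHT TIMES THE BUMP MASS**: `|(Qφ_i)_{i′}| ≤ L^{−j′D}·Στ·(Στ_⊥)^d`.
[cite: Balaban1984PropagatorsII, (2.147) p.248; Balaban1984PropagatorsI, (1.18) p.20] -/
theorem pair_le (i i' : BondIdx (domT hN D hk)) :
    |QE (domT hN D hk) (bump hN D hk i) i'| ≤ ((((ℓ + 1 : ℕ) : ℝ) ^ (d + 1)) ^ (lvl hN D hk i'))⁻¹ * (tsumL hN D hk i * Tsum (ℓ := ℓ) (lvl hN D hk i) ^ d) := by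
  classical
  have hsum : QE (domT hN D hk) (bump hN D hk i) i = 1 * (∑ t : Fin ((ℓ + 1) ^ (lvl hN D hk i)), (fun _ : ℕ => (1 : ℝ)) t * tauL hN D hk i t) *
      Tsum (ℓ := ℓ) (lvl hN D hk i) ^ d → True := fun _ => trivial
  clear hsum
  -- `0 ≤ q ≤ L^{−j′D}` and `φ ≥ 0`
  rw [QE_apply_eq_sum_qwt]
  have hnn : ∀ f, 0 ≤ qwt hN D hk i' f * bump hN D hk i f := fun f => mul_nonneg (qwt_nonneg hN D hk i' f) (bumpFn_nonneg hN D hk i f)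
  rw [abs_of_nonneg (Finset.sum_nonneg fun f _ => hnn f)]
  calc ∑ f, qwt hN D hk i' f * bump hN D hk i f ≤ ∑ f, ((((ℓ + 1 : ℕ) : ℝ) ^ (d + 1)) ^ (lvl hN D hk i'))⁻¹ * bump hN D hk i f :=
        Finset.sum_le_sum fun f _ => mul_le_mul_of_nonneg_right (qwt_le hN D hk i' f) (bumpFn_nonneg hN D hk i f)
    _ = ((((ℓ + 1 : ℕ) : ℝ) ^ (d + 1)) ^ (lvl hN D hk i'))⁻¹ * ∑ f, bump hN D hk i f := by rw [Finset.mul_sum]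
    _ = _ := by rw [sum_bump]
  where
  /-- the total mass of the bump: `Σ_f φ_i(f) = Στ·(Στ_⊥)^d`. [cite: Balaban1984PropagatorsII, (2.147) p.248, bookkeeping] -/
  sum_bump : ∑ f, bump hN D hk i f = tsumL hN D hk i * Tsum (ℓ := ℓ) (lvl hN D hk i) ^ d := by
    classical
    -- the pairing formula with the constant weight `1`: reuse `pair_eq_of_weight` with a fictitious weight is not available, so compute directly
    set j := lvl hN D hk i
    set μ := i.1.2.dir
    rw [B10StarCount.sum_pbond]
    have h1 : ∀ z : Site (PV d ℓ m K hd hL) 0, (∑ ν : Fin (d + 1), bump hN D hk i ⟨z, ν⟩) =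
        if z ∈ iterBlock j (base hN D hk i) then tauL hN D hk i (loc j z μ) * ∏ ν ∈ Finset.univ.erase μ, tauT (ℓ := ℓ) j (loc j z ν) else 0 := by
      intro z
      have hb : ∀ ν, bump hN D hk i ⟨z, ν⟩ = if ν = μ ∧ z ∈ iterBlock j (base hN D hk i) then
          tauL hN D hk i (loc j z μ) * ∏ ν ∈ Finset.univ.erase μ, tauT (ℓ := ℓ) j (loc j z ν) else 0 := fun ν => rfl
      simp_rw [hb]
      by_cases hz : z ∈ iterBlock j (base hN D hk i)
      · rw [if_pos hz, Finset.sum_eq_single μ (fun ν _ hν => by rw [if_neg (fun h => hν h.1)]) (fun h => absurd (Finset.mem_univ μ) h),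
          if_pos ⟨rfl, hz⟩]
      · rw [if_neg hz]; exact Finset.sum_eq_zero fun ν _ => by rw [if_neg (fun h => hz h.2)]
    rw [Finset.sum_congr rfl fun z _ => h1 z, ← Finset.sum_filter, Finset.filter_mem_eq_inter, Finset.univ_inter]
    set g : Fin (d + 1) → ℕ → ℝ := fun ν u => if ν = μ then tauL hN D hk i u else tauT (ℓ := ℓ) j u with hg
    have h2 : ∀ z ∈ iterBlock j (base hN D hk i),
        tauL hN D hk i (loc j z μ) * ∏ ν ∈ Finset.univ.erase μ, tauT (ℓ := ℓ) j (loc j z ν) = ∏ ν, g ν (loc j z ν) := by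
      intro z _
      rw [← Finset.mul_prod_erase Finset.univ (fun ν => g ν (loc j z ν)) (Finset.mem_univ μ)]
      simp only [hg, if_true]
      congr 1
      exact Finset.prod_congr rfl fun ν hν => by rw [if_neg (Finset.ne_of_mem_erase hν)]
    rw [Finset.sum_congr rfl h2, sum_block_prod (lvl_le_mK hN D hk i),
      ← Finset.mul_prod_erase Finset.univ (fun ν => ∑ t : Fin ((ℓ + 1) ^ j), g ν t) (Finset.mem_univ μ)]
    simp only [hg, if_true]
    rw [Finset.prod_congr rfl fun ν hν => by rw [show (∑ t : Fin ((ℓ + 1) ^ j), if ν = μ then tauL hN D hk i t else tauT (ℓ := ℓ) j t) =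
        Tsum (ℓ := ℓ) j from Finset.sum_congr rfl fun t _ => by rw [if_neg (Finset.ne_of_mem_erase hν)]],
      Finset.prod_const, Finset.card_erase_of_mem (Finset.mem_univ μ), Finset.card_univ, Fintype.card_fin]
    rfl

/-- **VANISHING FOR OTHER DIRECTIONS.** [cite: Balaban1984PropagatorsI, (1.18) p.20] -/
theorem pair_eq_zero_of_dir_ne (i i' : BondIdx (domT hN D hk)) (hdir : i'.1.2.dir ≠ i.1.2.dir) :
    QE (domT hN D hk) (bump hN D hk i) i' = 0 := by
  rw [QE_apply_eq_sum_qwt]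
  refine Finset.sum_eq_zero fun f _ => ?_
  by_cases hf : f.dir = i.1.2.dir
  · rw [qwt_eq_zero_of_dir_ne hN D hk i' (by rw [hf]; exact fun h => hdir h.symm), zero_mul]
  · have : bump hN D hk i f = 0 := by
      show bumpFn hN D hk i f = 0
      unfold bumpFn; rw [if_neg (fun h => hf h.1)]
    rw [this, mul_zero]

/-- **VANISHING WHEN THE DOUBLE BLOCK OF `i′` MISSES THE BASE BLOCK OF `i`.** [cite: Balaban1984PropagatorsI, (1.18) p.20] -/
theorem pair_eq_zero_of_disjoint (i i' : BondIdx (domT hN D hk))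
    (h1 : Disjoint (iterBlock (lvl hN D hk i') i'.1.2.src) (iterBlock (lvl hN D hk i) (base hN D hk i)))
    (h2 : Disjoint (iterBlock (lvl hN D hk i') i'.1.2.tgt) (iterBlock (lvl hN D hk i) (base hN D hk i))) :
    QE (domT hN D hk) (bump hN D hk i) i' = 0 := by
  rw [QE_apply_eq_sum_qwt]
  refine Finset.sum_eq_zero fun f _ => ?_
  by_cases hf : f.src ∈ iterBlock (lvl hN D hk i) (base hN D hk i)
  · rw [qwt_eq_zero_of_not_mem hN D hk i' (fun h => Finset.disjoint_left.1 h1 h hf) (fun h => Finset.disjoint_left.1 h2 h hf), zero_mul]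
  · have : bump hN D hk i f = 0 := by
      show bumpFn hN D hk i f = 0
      unfold bumpFn; rw [if_neg (fun h => hf h.2)]
    rw [this, mul_zero]

end Pairings

/-! ## §5  The rows of the pairing matrix: mass, the same-level partner, the level window -/

section Rows

open B5Eq118OneStroke (iterBlock iterBlockOf mem_iterBlock mem_iterBlock_iff)
open B6MultiLevelBoxOperator (N0)
open B6MultiLevelTorusOperator (TDomains)
open B6GlobalChartV1 (PV domT toBox)
open B6AgreeQaQV1Chart (iterBlock_nonempty)
open B6Ineq2142KLevelV1 (lvl lvl_le_mK one_le_lvl base cQ cQ_pos qwt qwt_nonneg exists_of_qwt_ne_zero iterBlockOf_runSite_mem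
  lev_le_of_ends pred_le_lev_of_ends lev_eq_of_base shift_injective)

variable {d ℓ m K : ℕ} {hd : 1 ≤ d + 1} {hL : Odd (ℓ + 1) ∧ 1 < ℓ + 1}
variable {Mh k R : ℕ} {P' : Fin (d + 1) → ℕ}
variable (hN : ∀ μ, N0 ℓ Mh k P' μ = (PV d ℓ m K hd hL).sitesPerDir 0) (D : TDomains d ℓ Mh k P' R) (hk : k ≤ m + K)

/-- blocks of one level determine their label. [cite: Balaban1984PropagatorsI, (1.6) p.18, bookkeeping] -/
theorem iterBlock_injective {n : ℕ} (hn : n ≤ m + K) : Function.Injective (iterBlock n : Site (PV d ℓ m K hd hL) n → Finset (Site (PV d ℓ m K hd hL) 0)) := by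
  intro y y' h
  obtain ⟨z, hz⟩ := iterBlock_nonempty (P := PV d ℓ m K hd hL) hn y
  have hz' : z ∈ iterBlock n y' := h ▸ hz
  rw [mem_iterBlock] at hz hz'
  rw [← hz, ← hz']

/-- the two affine coefficients in case A (`b₋ ∈ Ω_j`): `ctr + 1 = L^j − r`, `L^j − 1 − ctr = r`. [cite: Balaban1984PropagatorsII, (2.147) p.248, bookkeeping] -/
theorem ctr_caseA (i : BondIdx (domT hN D hk)) (hA : i.1.2.src ∈ (domT hN D hk).Om (lvl hN D hk i)) :
    (ctr hN D hk i : ℝ) + 1 = (((ℓ + 1) ^ (lvl hN D hk i) : ℕ) : ℝ) - rad hN D hk i ∧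
      (((ℓ + 1) ^ (lvl hN D hk i) : ℕ) : ℝ) - 1 - ctr hN D hk i = rad hN D hk i := by
  have h5 := five_mul_rad_le hN D hk i
  have hS : 1 ≤ (ℓ + 1) ^ (lvl hN D hk i) := Nat.one_le_pow _ _ (by omega)
  have hc : ctr hN D hk i = (ℓ + 1) ^ (lvl hN D hk i) - 1 - rad hN D hk i := by unfold ctr; rw [if_pos hA]
  have hcast : (ctr hN D hk i : ℝ) = (((ℓ + 1) ^ (lvl hN D hk i) : ℕ) : ℝ) - 1 - rad hN D hk i := by
    rw [hc, Nat.cast_sub (by omega), Nat.cast_sub hS]; push_cast; ring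
  constructor <;> linarith

/-- the two affine coefficients in case B (`b₋ ∉ Ω_j`): `ctr + 1 = r`, `L^j − 1 − ctr = L^j − r`. [cite: Balaban1984PropagatorsII, (2.147) p.248, bookkeeping] -/
theorem ctr_caseB (hk1 : 1 ≤ k) (hℓ : 4 ≤ ℓ) (i : BondIdx (domT hN D hk)) (hB : i.1.2.src ∉ (domT hN D hk).Om (lvl hN D hk i)) :
    (ctr hN D hk i : ℝ) + 1 = rad hN D hk i ∧
      (((ℓ + 1) ^ (lvl hN D hk i) : ℕ) : ℝ) - 1 - ctr hN D hk i = (((ℓ + 1) ^ (lvl hN D hk i) : ℕ) : ℝ) - rad hN D hk i := by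
  have hr := one_le_rad hN D hk hk1 hℓ i
  have hc : ctr hN D hk i = rad hN D hk i - 1 := by unfold ctr; rw [if_neg hB]
  have hcast : (ctr hN D hk i : ℝ) = (rad hN D hk i : ℝ) - 1 := by rw [hc, Nat.cast_sub hr]; push_cast; ring
  constructor <;> linarith

/-- the base block is the source block in case A, the target block in case B. [cite: Balaban1984PropagatorsII, (2.3) p.224, bookkeeping] -/
theorem base_eq_src_of (i : BondIdx (domT hN D hk)) (hA : i.1.2.src ∈ (domT hN D hk).Om (lvl hN D hk i)) : base hN D hk i = i.1.2.src := by
  unfold base; rw [if_pos hA]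

/-- companion of `base_eq_src_of`. [cite: Balaban1984PropagatorsII, (2.3) p.224, bookkeeping] -/
theorem base_eq_tgt_of (i : BondIdx (domT hN D hk)) (hB : i.1.2.src ∉ (domT hN D hk).Om (lvl hN D hk i)) : base hN D hk i = i.1.2.tgt := by
  unfold base; rw [if_neg hB]

/-- `Στ > 0` (the centre term is `r ≥ 1`). [cite: Balaban1984PropagatorsII, (2.147) p.248, bookkeeping] -/
theorem tsumL_pos (hk1 : 1 ≤ k) (hℓ : 4 ≤ ℓ) (i : BondIdx (domT hN D hk)) : 0 < tsumL hN D hk i := by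
  have hr := one_le_rad hN D hk hk1 hℓ i
  have hfit := ctr_fit hN D hk i
  have hc : ctr hN D hk i < (ℓ + 1) ^ (lvl hN D hk i) := by omega
  unfold tsumL
  have hle := Finset.single_le_sum (f := fun t : Fin ((ℓ + 1) ^ (lvl hN D hk i)) => tauL hN D hk i t) (fun t _ => tauL_nonneg hN D hk i t)
    (Finset.mem_univ (⟨ctr hN D hk i, hc⟩ : Fin ((ℓ + 1) ^ (lvl hN D hk i))))
  refine lt_of_lt_of_le ?_ hle
  show 0 < tauL hN D hk i (ctr hN D hk i)
  unfold tauL; simp only [sub_self, abs_zero, sub_zero]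
  rw [lt_max_iff]; right; exact_mod_cast hr

/-- `Στ_⊥ > 0` (every term is `≥ 1`). [cite: Balaban1984PropagatorsII, (2.147) p.248, bookkeeping] -/
theorem Tsum_pos (j : ℕ) : 0 < Tsum (ℓ := ℓ) j := by
  unfold Tsum
  have h0 : 0 < (ℓ + 1) ^ j := by positivity
  have hle := Finset.single_le_sum (f := fun t : Fin ((ℓ + 1) ^ j) => tauT (ℓ := ℓ) j t) (fun t _ => zero_le_one.trans (one_le_tauT (ℓ := ℓ) t.2))
    (Finset.mem_univ (⟨0, h0⟩ : Fin ((ℓ + 1) ^ j)))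
  exact lt_of_lt_of_le (lt_of_lt_of_le zero_lt_one (one_le_tauT (ℓ := ℓ) h0)) hle

/-- **THE MASS `m_i = (Qφ_i)_i = c_Q·(L^j − r)·Στ·(Στ_⊥)^d`** in both cases. [cite: Balaban1984PropagatorsII, (2.147) p.248; Balaban1984PropagatorsI, (1.18) p.20] -/
theorem mass_eq (hk1 : 1 ≤ k) (hℓ : 4 ≤ ℓ) (i : BondIdx (domT hN D hk)) (hper : 2 ≤ (PV d ℓ m K hd hL).sitesPerDir (lvl hN D hk i)) :
    QE (domT hN D hk) (bump hN D hk i) i =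
      cQ (d := d) (ℓ := ℓ) (lvl hN D hk i) * ((((ℓ + 1) ^ (lvl hN D hk i) : ℕ) : ℝ) - rad hN D hk i) * tsumL hN D hk i *
        Tsum (ℓ := ℓ) (lvl hN D hk i) ^ d := by
  by_cases hA : i.1.2.src ∈ (domT hN D hk).Om (lvl hN D hk i)
  · rw [pair_src hN D hk i i hper rfl rfl (by rw [base_eq_src_of hN D hk i hA]), (ctr_caseA hN D hk i hA).1]
  · rw [pair_tgt hN D hk i i hper rfl rfl (by rw [base_eq_tgt_of hN D hk i hA]), (ctr_caseB hN D hk hk1 hℓ i hA).2]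

/-- `m_i > 0`. [cite: Balaban1984PropagatorsII, (2.147) p.248, bookkeeping] -/
theorem mass_pos (hk1 : 1 ≤ k) (hℓ : 4 ≤ ℓ) (i : BondIdx (domT hN D hk)) (hper : 2 ≤ (PV d ℓ m K hd hL).sitesPerDir (lvl hN D hk i)) :
    0 < QE (domT hN D hk) (bump hN D hk i) i := by
  rw [mass_eq hN D hk hk1 hℓ i hper]
  have h5 := five_mul_rad_le hN D hk i
  have hr := one_le_rad hN D hk hk1 hℓ i
  have hSr : (0 : ℝ) < (((ℓ + 1) ^ (lvl hN D hk i) : ℕ) : ℝ) - rad hN D hk i := by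
    have : rad hN D hk i < (ℓ + 1) ^ (lvl hN D hk i) := by omega
    have := (Nat.cast_lt (α := ℝ)).2 this; linarith
  have h1 := tsumL_pos hN D hk hk1 hℓ i
  have h2 := Tsum_pos (ℓ := ℓ) (lvl hN D hk i)
  have h3 := cQ_pos (d := d) (ℓ := ℓ) (lvl hN D hk i)
  positivity

/-- **THE SAME-LEVEL PARTNER**: a level-`j`, direction-`μ_i` index bond `i′ ≠ i` one of whose end blocks is the base block of `i` pairs with `φ_i` to
EXACTLY `c_Q·r·Στ·(Στ_⊥)^d = (r/(L^j − r))·m_i` (in case A it is `⟨b₋ − e_μ, b₋⟩` seeing `B(b₋)` as its target block, in case B it is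
`⟨b₊, b₊ + e_μ⟩` seeing `B(b₊)` as its source block). [cite: Balaban1984PropagatorsII, (2.147) p.248; Balaban1984PropagatorsI, (1.18) p.20] -/
theorem partner_eq (hk1 : 1 ≤ k) (hℓ : 4 ≤ ℓ) (i i' : BondIdx (domT hN D hk)) (hper : 2 ≤ (PV d ℓ m K hd hL).sitesPerDir (lvl hN D hk i'))
    (hj : lvl hN D hk i' = lvl hN D hk i) (hdir : i'.1.2.dir = i.1.2.dir) (hne : i' ≠ i)
    (h : iterBlock (lvl hN D hk i') i'.1.2.src = iterBlock (lvl hN D hk i) (base hN D hk i) ∨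
      iterBlock (lvl hN D hk i') i'.1.2.tgt = iterBlock (lvl hN D hk i) (base hN D hk i)) :
    QE (domT hN D hk) (bump hN D hk i) i' = cQ (d := d) (ℓ := ℓ) (lvl hN D hk i) * rad hN D hk i * tsumL hN D hk i * Tsum (ℓ := ℓ) (lvl hN D hk i) ^ d := by
  -- the index bonds as level/bond pairs
  obtain ⟨⟨j₁, b₁⟩, hb₁⟩ := i'
  obtain ⟨⟨j₀, b₀⟩, hb₀⟩ := i
  have hjj : j₁ = j₀ := Fin.ext (by simpa [lvl] using hj)
  subst hjj
  simp only at hdir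
  -- `i′ = i` would follow from equal sources
  have hsrc_ne : b₁.src ≠ b₀.src := by
    intro hs
    apply hne
    have : b₁ = b₀ := by cases b₁; cases b₀; simp only at hs hdir; simp [hs, hdir]
    subst this; rfl
  rcases h with h | h
  · -- source-type: then case B for `i` (else `b₁.src = b₀.src`)
    rw [pair_src hN D hk _ _ hper hj hdir h]
    by_cases hA : b₀.src ∈ (domT hN D hk).Om (lvl hN D hk ⟨⟨j₁, b₀⟩, hb₀⟩)
    · exfalso
      rw [base_eq_src_of hN D hk _ hA] at h
      exact hsrc_ne (iterBlock_injective (lvl_le_mK hN D hk ⟨⟨j₁, b₀⟩, hb₀⟩) h)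
    · rw [(ctr_caseB hN D hk hk1 hℓ _ hA).1]
  · -- target-type: then case A for `i` (else `b₁.tgt = b₀.tgt`)
    rw [pair_tgt hN D hk _ _ hper hj hdir h]
    by_cases hA : b₀.src ∈ (domT hN D hk).Om (lvl hN D hk ⟨⟨j₁, b₀⟩, hb₀⟩)
    · rw [(ctr_caseA hN D hk _ hA).2]
    · exfalso
      rw [base_eq_tgt_of hN D hk _ hA] at h
      have htgt : b₁.tgt = b₀.tgt := iterBlock_injective (lvl_le_mK hN D hk ⟨⟨j₁, b₀⟩, hb₀⟩) h
      unfold PBond.tgt at htgt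
      rw [hdir] at htgt
      exact hsrc_ne (shift_injective b₀.dir htgt)

/-- hence **the partner pairing is at most a quarter of the mass** (`r/(L^j − r) ≤ 1/4` as `5r ≤ L^j`). [cite: Balaban1984PropagatorsII, (2.147) p.248, bookkeeping] -/
theorem partner_le (hk1 : 1 ≤ k) (hℓ : 4 ≤ ℓ) (i i' : BondIdx (domT hN D hk)) (hper' : 2 ≤ (PV d ℓ m K hd hL).sitesPerDir (lvl hN D hk i'))
    (hper : 2 ≤ (PV d ℓ m K hd hL).sitesPerDir (lvl hN D hk i))
    (hj : lvl hN D hk i' = lvl hN D hk i) (hdir : i'.1.2.dir = i.1.2.dir) (hne : i' ≠ i)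
    (h : iterBlock (lvl hN D hk i') i'.1.2.src = iterBlock (lvl hN D hk i) (base hN D hk i) ∨
      iterBlock (lvl hN D hk i') i'.1.2.tgt = iterBlock (lvl hN D hk i) (base hN D hk i)) :
    0 ≤ QE (domT hN D hk) (bump hN D hk i) i' ∧ QE (domT hN D hk) (bump hN D hk i) i' ≤ (1 / 4) * QE (domT hN D hk) (bump hN D hk i) i := by
  rw [partner_eq hN D hk hk1 hℓ i i' hper' hj hdir hne h, mass_eq hN D hk hk1 hℓ i hper]
  have h5 := five_mul_rad_le hN D hk i
  have h5' : 5 * (rad hN D hk i : ℝ) ≤ (((ℓ + 1) ^ (lvl hN D hk i) : ℕ) : ℝ) := by exact_mod_cast h5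
  have hc := cQ_pos (d := d) (ℓ := ℓ) (lvl hN D hk i)
  have ht : 0 < tsumL hN D hk i * Tsum (ℓ := ℓ) (lvl hN D hk i) ^ d :=
    mul_pos (tsumL_pos hN D hk hk1 hℓ i) (pow_pos (Tsum_pos (ℓ := ℓ) _) _)
  have hr0 : (0 : ℝ) ≤ rad hN D hk i := Nat.cast_nonneg _
  constructor
  · have := mul_nonneg (mul_nonneg hc.le hr0) ht.le
    calc (0 : ℝ) ≤ cQ (d := d) (ℓ := ℓ) (lvl hN D hk i) * rad hN D hk i * (tsumL hN D hk i * Tsum (ℓ := ℓ) (lvl hN D hk i) ^ d) := this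
      _ = _ := by ring
  · have key : cQ (d := d) (ℓ := ℓ) (lvl hN D hk i) * rad hN D hk i * (tsumL hN D hk i * Tsum (ℓ := ℓ) (lvl hN D hk i) ^ d) ≤
        (1 / 4) * (cQ (d := d) (ℓ := ℓ) (lvl hN D hk i) * ((((ℓ + 1) ^ (lvl hN D hk i) : ℕ) : ℝ) - rad hN D hk i) *
          (tsumL hN D hk i * Tsum (ℓ := ℓ) (lvl hN D hk i) ^ d)) := by
      rw [← mul_assoc (1 / 4 : ℝ), ← mul_assoc (1 / 4 : ℝ)]
      refine mul_le_mul_of_nonneg_right ?_ ht.le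
      rw [mul_assoc (1 / 4 : ℝ), mul_left_comm]
      refine mul_le_mul_of_nonneg_left ?_ hc.le
      linarith
    calc cQ (d := d) (ℓ := ℓ) (lvl hN D hk i) * rad hN D hk i * tsumL hN D hk i * Tsum (ℓ := ℓ) (lvl hN D hk i) ^ d
        = cQ (d := d) (ℓ := ℓ) (lvl hN D hk i) * rad hN D hk i * (tsumL hN D hk i * Tsum (ℓ := ℓ) (lvl hN D hk i) ^ d) := by ring
      _ ≤ _ := key
      _ = _ := by ring

/-- **THE LEVEL WINDOW**: `(Qφ_i)_{i′} ≠ 0 ⇒ j(i) ≤ j(i′) ≤ j(i) + 1` (the double block of `i′` has site levels in `{j(i′) − 1, j(i′)}`, the base block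
of `i` has level `j(i)`). [cite: Balaban1984PropagatorsII, (2.1)–(2.3) p.224, (2.45) p.231] -/
theorem level_window (hk1 : 1 ≤ k) (hRM : 2 ≤ R * Mh) (i i' : BondIdx (domT hN D hk)) (hne0 : QE (domT hN D hk) (bump hN D hk i) i' ≠ 0) :
    lvl hN D hk i ≤ lvl hN D hk i' ∧ lvl hN D hk i' ≤ lvl hN D hk i + 1 := by
  classical
  rw [QE_apply_eq_sum_qwt] at hne0
  obtain ⟨f, -, hf⟩ := Finset.exists_ne_zero_of_sum_ne_zero hne0
  have hq : qwt hN D hk i' f ≠ 0 := left_ne_zero_of_mul hf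
  have hb : bump hN D hk i f ≠ 0 := right_ne_zero_of_mul hf
  have hsrc : f.src ∈ iterBlock (lvl hN D hk i) (base hN D hk i) := by
    by_contra h
    apply hb
    show bumpFn hN D hk i f = 0
    unfold bumpFn; rw [if_neg (fun h' => h h'.2)]
  rw [mem_iterBlock] at hsrc
  have hlev := lev_eq_of_base hN D hk hk1 i hsrc
  obtain ⟨x, hx, t, ht, hxt⟩ := exists_of_qwt_ne_zero hN D hk i' hq
  rw [mem_iterBlock] at hx
  have hends : iterBlockOf (lvl hN D hk i') f.src = i'.1.2.src ∨ iterBlockOf (lvl hN D hk i') f.src = i'.1.2.tgt := by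
    have hs : f.src = runSite x i'.1.2.dir t := by rw [← hxt]; rfl
    rcases iterBlockOf_runSite_mem (lvl_le_mK hN D hk i') x i'.1.2.dir ht.le with h' | h'
    · left; rw [hs, h', hx]
    · right; rw [hs, h', hx]; rfl
  have h1 := lev_le_of_ends hN D hk i' hends
  have h2 := pred_le_lev_of_ends hN D hk hk1 hRM i' hends
  constructor <;> omega

end Rows

/-! ## §6a  The energy of `Δ_a` is bounded by first differences (curl and divergence are combinations of differences, `‖R‖ ≤ 1`) -/

section Energy

open B6SectAOperatorsV1 (dcE dsE RE RE_apply KE dcE_apply dsE_apply inner_eq_sum)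
open B6SectAVectorModelV1 (inner_deltaAE_self)

variable {P : Params} (Dm : Domains P)

/-- the forward difference of a bond function in the direction `ν`: `(Δ_νA)(f) = A(f + e_ν) − A(f)`. [cite: Balaban1984PropagatorsI, (1.2)/(1.21) p.18–21, dictionary] -/
def bdiff (A : BondSpace P) (ν : Fin P.d) (f : PBond P 0) : ℝ := A ⟨f.src.shift ν, f.dir⟩ - A f

/-- **THE PLAQUETTE VARIABLE IS A DIFFERENCE OF TWO FIRST DIFFERENCES**: `(∂A)(p) = c·((Δ_μA_ν)(x) − (Δ_νA_μ)(x))`, so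
`(∂A)(p)² ≤ 2c²((Δ_μA_ν)(x)² + (Δ_νA_μ)(x)²)`. [cite: Balaban1984PropagatorsI, (1.2) p.18] -/
theorem curl_sq_le (c : ℝ) (A : BondSpace P) (p : Plaq P 0) :
    (curl c (WithLp.ofLp A) p) ^ 2 ≤ 2 * c ^ 2 * (bdiff A p.μ ⟨p.src, p.ν⟩ ^ 2 + bdiff A p.ν ⟨p.src, p.μ⟩ ^ 2) := by
  have h : curl c (WithLp.ofLp A) p = c * (bdiff A p.μ ⟨p.src, p.ν⟩ - bdiff A p.ν ⟨p.src, p.μ⟩) := by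
    simp only [curl, bdiff, smul_eq_mul]; ring
  rw [h]
  nlinarith [sq_nonneg (bdiff A p.μ ⟨p.src, p.ν⟩ + bdiff A p.ν ⟨p.src, p.μ⟩), sq_nonneg c]

/-- **`‖∂A‖² ≤ 2c²·Σ_fΣ_ν (Δ_νA)(f)²`.** [cite: Balaban1984PropagatorsI, (1.2)/(1.21) p.18–21] -/
theorem norm_dcE_sq_le (c : ℝ) (A : BondSpace P) :
    ‖dcE c A‖ ^ 2 ≤ 2 * c ^ 2 * ∑ f : PBond P 0, ∑ ν : Fin P.d, bdiff A ν f ^ 2 := by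
  classical
  rw [EuclideanSpace.norm_sq_eq]
  have h1 : ∀ p : Plaq P 0, ‖dcE c A p‖ ^ 2 ≤ 2 * c ^ 2 * (bdiff A p.μ ⟨p.src, p.ν⟩ ^ 2 + bdiff A p.ν ⟨p.src, p.μ⟩ ^ 2) := fun p => by
    rw [Real.norm_eq_abs, sq_abs, dcE_apply]; exact curl_sq_le c A p
  refine (Finset.sum_le_sum fun p _ => h1 p).trans ?_
  rw [← Finset.mul_sum, Finset.sum_add_distrib]
  refine mul_le_mul_of_nonneg_left ?_ (by positivity)
  -- both plaquette sums inject into the sum over (site, bond direction, difference direction)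
  set G : Site P 0 × Fin P.d × Fin P.d → ℝ := fun t => bdiff A t.2.2 ⟨t.1, t.2.1⟩ ^ 2 with hG
  have hG0 : ∀ t, 0 ≤ G t := fun t => sq_nonneg _
  have htot : ∑ f : PBond P 0, ∑ ν : Fin P.d, bdiff A ν f ^ 2 = ∑ t : Site P 0 × Fin P.d × Fin P.d, G t := by
    rw [B10StarCount.sum_pbond, Fintype.sum_prod_type]
    refine Finset.sum_congr rfl fun x _ => ?_
    rw [Fintype.sum_prod_type]
  have e1inj : Function.Injective (fun p : Plaq P 0 => (p.src, p.ν, p.μ)) := by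
    intro p q h; simp only [Prod.mk.injEq] at h; cases p; cases q; simp only at h; obtain ⟨h1, h2, h3⟩ := h; subst h1; subst h2; subst h3; rfl
  have e2inj : Function.Injective (fun p : Plaq P 0 => (p.src, p.μ, p.ν)) := by
    intro p q h; simp only [Prod.mk.injEq] at h; cases p; cases q; simp only at h; obtain ⟨h1, h2, h3⟩ := h; subst h1; subst h2; subst h3; rfl
  have hs1 : ∑ p : Plaq P 0, bdiff A p.μ ⟨p.src, p.ν⟩ ^ 2 ≤ ∑ t, G t := by
    have : ∑ p : Plaq P 0, bdiff A p.μ ⟨p.src, p.ν⟩ ^ 2 = ∑ t ∈ Finset.univ.map ⟨_, e1inj⟩, G t := by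
      rw [Finset.sum_map]; rfl
    rw [this]; exact Finset.sum_le_sum_of_subset_of_nonneg (Finset.subset_univ _) fun t _ _ => hG0 t
  have hs2 : ∑ p : Plaq P 0, bdiff A p.ν ⟨p.src, p.μ⟩ ^ 2 ≤ ∑ t, G t := by
    have : ∑ p : Plaq P 0, bdiff A p.ν ⟨p.src, p.μ⟩ ^ 2 = ∑ t ∈ Finset.univ.map ⟨_, e2inj⟩, G t := by
      rw [Finset.sum_map]; rfl
    rw [this]; exact Finset.sum_le_sum_of_subset_of_nonneg (Finset.subset_univ _) fun t _ _ => hG0 t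
  -- one of the two injections misses the diagonal, so together they cover `Σ_t G t` at most twice; we only need `≤ 2Σ`... but sharper: they are disjoint
  -- images (μ < ν vs ν < μ), hence the sum of both is `≤ Σ_t G t`.
  have hdisj : Disjoint (Finset.univ.map ⟨_, e1inj⟩) (Finset.univ.map ⟨_, e2inj⟩) := by
    rw [Finset.disjoint_left]
    rintro t ht1 ht2
    rw [Finset.mem_map] at ht1 ht2
    obtain ⟨p, -, hp⟩ := ht1
    obtain ⟨q, -, hq⟩ := ht2
    simp only [Function.Embedding.coeFn_mk] at hp hq
    have h := hp.trans hq.symm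
    simp only [Prod.mk.injEq] at h
    have := p.hμν; have := q.hμν
    rw [h.2.1, h.2.2] at *; omega
  have hboth : ∑ p : Plaq P 0, bdiff A p.μ ⟨p.src, p.ν⟩ ^ 2 + ∑ p : Plaq P 0, bdiff A p.ν ⟨p.src, p.μ⟩ ^ 2 ≤ ∑ t, G t := by
    have h1 : ∑ p : Plaq P 0, bdiff A p.μ ⟨p.src, p.ν⟩ ^ 2 = ∑ t ∈ Finset.univ.map ⟨_, e1inj⟩, G t := by rw [Finset.sum_map]; rfl
    have h2 : ∑ p : Plaq P 0, bdiff A p.ν ⟨p.src, p.μ⟩ ^ 2 = ∑ t ∈ Finset.univ.map ⟨_, e2inj⟩, G t := by rw [Finset.sum_map]; rfl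
    rw [h1, h2, ← Finset.sum_union hdisj]
    exact Finset.sum_le_sum_of_subset_of_nonneg (Finset.subset_univ _) fun t _ _ => hG0 t
  rw [htot]; exact hboth

/-- **`‖∂*A‖² ≤ D·c²·Σ_f (Δ_{μ(f)}A)(f)²`** (the divergence at `x` is the sum of the `D` differences `A(x − e_μ, μ) − A(x, μ)`).
[cite: Balaban1984PropagatorsI, (1.21) p.21] -/
theorem norm_dsE_sq_le (c : ℝ) (A : BondSpace P) :
    ‖dsE c A‖ ^ 2 ≤ P.d * c ^ 2 * ∑ f : PBond P 0, bdiff A f.dir f ^ 2 := by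
  classical
  rw [EuclideanSpace.norm_sq_eq]
  have h1 : ∀ x : Site P 0, ‖dsE c A x‖ ^ 2 ≤ P.d * c ^ 2 * ∑ μ : Fin P.d, bdiff A μ ⟨x.unshift μ, μ⟩ ^ 2 := fun x => by
    rw [Real.norm_eq_abs, sq_abs, dsE_apply]
    have hd : diverg c (WithLp.ofLp A) x = ∑ μ : Fin P.d, (-c) * bdiff A μ ⟨x.unshift μ, μ⟩ := by
      simp only [diverg, bdiff, smul_eq_mul, B10StarCount.shift_unshift]
      exact Finset.sum_congr rfl fun μ _ => by ring
    rw [hd]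
    calc (∑ μ : Fin P.d, -c * bdiff A μ ⟨x.unshift μ, μ⟩) ^ 2 ≤ (Finset.univ : Finset (Fin P.d)).card * ∑ μ : Fin P.d, (-c * bdiff A μ ⟨x.unshift μ, μ⟩) ^ 2 :=
          sq_sum_le_card_mul_sum_sq
      _ = P.d * c ^ 2 * ∑ μ : Fin P.d, bdiff A μ ⟨x.unshift μ, μ⟩ ^ 2 := by
          rw [Finset.card_univ, Fintype.card_fin, Finset.mul_sum, Finset.mul_sum]
          exact Finset.sum_congr rfl fun μ _ => by ring
  refine (Finset.sum_le_sum fun x _ => h1 x).trans ?_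
  rw [← Finset.mul_sum]
  refine mul_le_mul_of_nonneg_left (le_of_eq ?_) (by positivity)
  -- reindex `x ↦ x − e_μ`
  calc ∑ x : Site P 0, ∑ μ : Fin P.d, bdiff A μ ⟨x.unshift μ, μ⟩ ^ 2 = ∑ μ : Fin P.d, ∑ x : Site P 0, bdiff A μ ⟨x.unshift μ, μ⟩ ^ 2 :=
        Finset.sum_comm
    _ = ∑ μ : Fin P.d, ∑ z : Site P 0, bdiff A μ ⟨z, μ⟩ ^ 2 := Finset.sum_congr rfl fun μ _ =>
        Fintype.sum_equiv ⟨fun x => x.unshift μ, fun x => x.shift μ, fun x => B10StarCount.shift_unshift x μ, fun x => B10StarCount.unshift_shift x μ⟩ _ _ fun x => rfl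
    _ = ∑ z : Site P 0, ∑ μ : Fin P.d, bdiff A μ ⟨z, μ⟩ ^ 2 := Finset.sum_comm
    _ = ∑ f : PBond P 0, bdiff A f.dir f ^ 2 := (B10StarCount.sum_pbond (fun f : PBond P 0 => bdiff A f.dir f ^ 2)).symm

/-- **THE ENERGY BOUND**: `⟪A, Δ_aA⟫ ≤ c²·(D + 2)·Σ_fΣ_ν(Δ_νA)(f)² + Σ_i w_i(QA)_i²`. [cite: Balaban1984PropagatorsII, (2.18)–(2.19) p.226; Balaban1984PropagatorsI, (1.2)/(1.21) p.18–21] -/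
theorem energy_le (c : ℝ) (w : BondIdx Dm → ℝ) (A : BondSpace P) :
    ⟪A, deltaAE Dm c w A⟫_ℝ ≤ c ^ 2 * ((P.d : ℝ) + 2) * ∑ f : PBond P 0, ∑ ν : Fin P.d, bdiff A ν f ^ 2 + ∑ i, w i * QE Dm A i ^ 2 := by
  rw [inner_deltaAE_self]
  have hR : ‖RE Dm c (dsE c A)‖ ^ 2 ≤ ‖dsE c A‖ ^ 2 := by
    have h := Submodule.norm_starProjection_apply_le (KE Dm c) (dsE c A)
    rw [← RE_apply] at h
    exact pow_le_pow_left₀ (norm_nonneg _) h 2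
  have h1 := norm_dcE_sq_le c A
  have h2 := norm_dsE_sq_le c A
  have h3 : ∑ f : PBond P 0, bdiff A f.dir f ^ 2 ≤ ∑ f : PBond P 0, ∑ ν : Fin P.d, bdiff A ν f ^ 2 :=
    Finset.sum_le_sum fun f _ => Finset.single_le_sum (f := fun ν => bdiff A ν f ^ 2) (fun ν _ => sq_nonneg _) (Finset.mem_univ f.dir)
  have h2' : ‖dsE c A‖ ^ 2 ≤ P.d * c ^ 2 * ∑ f : PBond P 0, ∑ ν : Fin P.d, bdiff A ν f ^ 2 :=
    h2.trans (mul_le_mul_of_nonneg_left h3 (by positivity))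
  have hsplit : c ^ 2 * ((P.d : ℝ) + 2) * ∑ f : PBond P 0, ∑ ν : Fin P.d, bdiff A ν f ^ 2 =
      2 * c ^ 2 * ∑ f : PBond P 0, ∑ ν : Fin P.d, bdiff A ν f ^ 2 + P.d * c ^ 2 * ∑ f : PBond P 0, ∑ ν : Fin P.d, bdiff A ν f ^ 2 := by ring
  rw [hsplit]
  linarith

end Energy

/-! ## §6b  Locality: how many bumps a bond / a `Q`-row can see (fibres of `β`, W3; blocks met by a double block, W2) -/

section Locality

open B5Eq118OneStroke (iterBlock iterBlockOf mem_iterBlock)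
open B6MultiLevelBoxOperator (N0)
open B6MultiLevelTorusOperator (TDomains)
open B6GlobalChartV1 (PV domT toBox)
open B6Geom246MultiLevelBox (bset blkOf)
open B6Ineq2142KLevelV1 (lvl lvl_le_mK one_le_lvl base β blkOf_eq_beta qwt exists_of_qwt_ne_zero iterBlockOf_runSite_mem metBlocks mem_metBlocks
  card_metBlocks_le)
open B6Prop27KLevelV1 (card_fiber_beta_le)

variable {d ℓ m K : ℕ} {hd : 1 ≤ d + 1} {hL : Odd (ℓ + 1) ∧ 1 < ℓ + 1}
variable {Mh k R : ℕ} {P' : Fin (d + 1) → ℕ}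
variable (hN : ∀ μ, N0 ℓ Mh k P' μ = (PV d ℓ m K hd hL).sitesPerDir 0) (D : TDomains d ℓ Mh k P' R) (hk : k ≤ m + K)

/-- **CAUCHY–SCHWARZ ON THE SUPPORT**: `(Σ_i a_i y_i)² ≤ #S·Σ_i (a_i y_i)²` when `y` vanishes off `S`. [cite: Balaban1984PropagatorsII, (2.147) p.248, bookkeeping] -/
theorem sq_sum_le_card_support_mul {ι : Type*} [Fintype ι] [DecidableEq ι] (a y : ι → ℝ) (S : Finset ι) (hS : ∀ i, y i ≠ 0 → i ∈ S) :
    (∑ i, a i * y i) ^ 2 ≤ S.card * ∑ i, (a i * y i) ^ 2 := by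
  have h1 : ∑ i, a i * y i = ∑ i ∈ S, a i * y i := by
    rw [← Finset.sum_subset (Finset.subset_univ S)]
    intro i _ hi
    have : y i = 0 := by by_contra h; exact hi (hS i h)
    rw [this, mul_zero]
  have h2 : ∑ i ∈ S, (a i * y i) ^ 2 ≤ ∑ i, (a i * y i) ^ 2 :=
    Finset.sum_le_sum_of_subset_of_nonneg (Finset.subset_univ S) fun i _ _ => sq_nonneg _
  rw [h1]
  exact sq_sum_le_card_mul_sum_sq.trans (mul_le_mul_of_nonneg_left h2 (Nat.cast_nonneg _))

/-- where a bump is nonzero: direction `μ_i`, source in the base block. [cite: Balaban1984PropagatorsII, (2.147) p.248, bookkeeping] -/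
theorem bump_ne_zero_imp (i : BondIdx (domT hN D hk)) {f : PBond (PV d ℓ m K hd hL) 0} (h : bump hN D hk i f ≠ 0) :
    f.dir = i.1.2.dir ∧ f.src ∈ iterBlock (lvl hN D hk i) (base hN D hk i) := by
  by_contra hc
  apply h
  show bumpFn hN D hk i f = 0
  unfold bumpFn; rw [if_neg hc]

/-- the carrier block of a bump seeing the bond `f` is the `𝔅`-block of `f₋`. [cite: Balaban1984PropagatorsII, (2.45) p.231, bookkeeping] -/
theorem beta_eq_of_bump_ne_zero (hk1 : 1 ≤ k) (i : BondIdx (domT hN D hk)) {f : PBond (PV d ℓ m K hd hL) 0} (h : bump hN D hk i f ≠ 0) :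
    β hN D hk i = blkOf D.toDomains (toBox hN f.src) := by
  have h2 := (bump_ne_zero_imp hN D hk i h).2
  rw [mem_iterBlock] at h2
  exact (blkOf_eq_beta hN D hk hk1 i h2).symm

/-- **AT MOST `2D` BUMPS ARE NONZERO ON A GIVEN BOND.** [cite: Balaban1984PropagatorsII, (2.147) p.248, (2.45) p.231, bookkeeping] -/
theorem card_bump_support_le (hk1 : 1 ≤ k) (f : PBond (PV d ℓ m K hd hL) 0) :
    (Finset.univ.filter fun i : BondIdx (domT hN D hk) => bump hN D hk i f ≠ 0).card ≤ 2 * (d + 1) := by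
  classical
  refine le_trans (Finset.card_le_card fun i hi => ?_) (card_fiber_beta_le hN D hk hk1 (blkOf D.toDomains (toBox hN f.src)))
  rw [Finset.mem_filter] at hi ⊢
  exact ⟨hi.1, beta_eq_of_bump_ne_zero hN D hk hk1 i hi.2⟩

/-- **THE GRADIENT OF A SUPERPOSITION OF BUMPS IS LOCAL**: `(Σ_i a_i(Δ_νφ_i)(f))² ≤ 4D·Σ_i a_i²(Δ_νφ_i)(f)²`.
[cite: Balaban1984PropagatorsII, (2.147) p.248, bookkeeping] -/
theorem grad_sq_le (hk1 : 1 ≤ k) (a : BondIdx (domT hN D hk) → ℝ) (f : PBond (PV d ℓ m K hd hL) 0) (ν : Fin (d + 1)) :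
    (∑ i, a i * bdiff (bump hN D hk i) ν f) ^ 2 ≤ (4 * ((d : ℝ) + 1)) * ∑ i, (a i * bdiff (bump hN D hk i) ν f) ^ 2 := by
  classical
  set S := (Finset.univ.filter fun i : BondIdx (domT hN D hk) => bump hN D hk i f ≠ 0) ∪
    (Finset.univ.filter fun i : BondIdx (domT hN D hk) => bump hN D hk i ⟨f.src.shift ν, f.dir⟩ ≠ 0) with hSdef
  have hS : ∀ i, bdiff (bump hN D hk i) ν f ≠ 0 → i ∈ S := by
    intro i hi
    rw [hSdef, Finset.mem_union, Finset.mem_filter, Finset.mem_filter]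
    by_contra hc
    rw [not_or] at hc
    apply hi
    unfold bdiff
    have h1 : bump hN D hk i ⟨f.src.shift ν, f.dir⟩ = 0 := by by_contra h; exact hc.2 ⟨Finset.mem_univ _, h⟩
    have h2 : bump hN D hk i f = 0 := by by_contra h; exact hc.1 ⟨Finset.mem_univ _, h⟩
    rw [h1, h2, sub_zero]
  have hcard : (S.card : ℝ) ≤ 4 * ((d : ℝ) + 1) := by
    have h := (Finset.card_union_le _ _).trans (Nat.add_le_add (card_bump_support_le hN D hk hk1 f) (card_bump_support_le hN D hk hk1 ⟨f.src.shift ν, f.dir⟩))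
    rw [hSdef]
    have : (S.card : ℝ) ≤ ((2 * (d + 1) + 2 * (d + 1) : ℕ) : ℝ) := by rw [hSdef]; exact_mod_cast h
    push_cast at this; linarith
  refine (sq_sum_le_card_support_mul a _ S hS).trans ?_
  exact mul_le_mul_of_nonneg_right hcard (Finset.sum_nonneg fun i _ => sq_nonneg _)

/-- a bump seen by the `Q`-row of `i′` has its carrier block among the blocks met by the double block of `i′`. [cite: Balaban1984PropagatorsII, (2.45) p.231, bookkeeping] -/
theorem beta_mem_metBlocks_of_pair_ne_zero (hk1 : 1 ≤ k) (i i' : BondIdx (domT hN D hk)) (h : QE (domT hN D hk) (bump hN D hk i) i' ≠ 0) :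
    β hN D hk i ∈ metBlocks hN D hk i' := by
  classical
  rw [QE_apply_eq_sum_qwt] at h
  obtain ⟨f, -, hf⟩ := Finset.exists_ne_zero_of_sum_ne_zero h
  have hq : qwt hN D hk i' f ≠ 0 := left_ne_zero_of_mul hf
  have hb : bump hN D hk i f ≠ 0 := right_ne_zero_of_mul hf
  rw [beta_eq_of_bump_ne_zero hN D hk hk1 i hb]
  obtain ⟨x, hx, t, ht, hxt⟩ := exists_of_qwt_ne_zero hN D hk i' hq
  rw [mem_iterBlock] at hx
  refine mem_metBlocks hN D hk i' ?_
  have hs : f.src = runSite x i'.1.2.dir t := by rw [← hxt]; rfl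
  rcases iterBlockOf_runSite_mem (lvl_le_mK hN D hk i') x i'.1.2.dir ht.le with h' | h'
  · left; rw [hs, h', hx]
  · right; rw [hs, h', hx]; rfl

/-- **AT MOST `4D·L^D` BUMPS ARE SEEN BY ONE `Q`-ROW.** [cite: Balaban1984PropagatorsII, (2.45) p.231, (2.147) p.248, bookkeeping] -/
theorem card_pair_support_le (hk1 : 1 ≤ k) (hRM : 2 ≤ R * Mh) (i' : BondIdx (domT hN D hk)) :
    (Finset.univ.filter fun i : BondIdx (domT hN D hk) => QE (domT hN D hk) (bump hN D hk i) i' ≠ 0).card ≤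
      2 * (ℓ + 1) ^ (d + 1) * (2 * (d + 1)) := by
  classical
  have hsub : (Finset.univ.filter fun i : BondIdx (domT hN D hk) => QE (domT hN D hk) (bump hN D hk i) i' ≠ 0) ⊆
      (metBlocks hN D hk i').biUnion fun y => Finset.univ.filter fun i : BondIdx (domT hN D hk) => β hN D hk i = y := by
    intro i hi
    rw [Finset.mem_filter] at hi
    rw [Finset.mem_biUnion]
    exact ⟨β hN D hk i, beta_mem_metBlocks_of_pair_ne_zero hN D hk hk1 i i' hi.2, by rw [Finset.mem_filter]; exact ⟨Finset.mem_univ _, rfl⟩⟩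
  refine (Finset.card_le_card hsub).trans (Finset.card_biUnion_le.trans ?_)
  refine (Finset.sum_le_sum fun y _ => card_fiber_beta_le hN D hk hk1 y).trans ?_
  rw [Finset.sum_const, smul_eq_mul]
  exact Nat.mul_le_mul_right _ (card_metBlocks_le hN D hk hk1 hRM i')

/-- **THE `Q`-ROWS OF A SUPERPOSITION OF BUMPS ARE LOCAL**: `(Σ_i a_i(Qφ_i)_{i′})² ≤ 4D·L^D·Σ_i a_i²(Qφ_i)_{i′}²`.
[cite: Balaban1984PropagatorsII, (2.147) p.248, bookkeeping] -/
theorem qrow_sq_le (hk1 : 1 ≤ k) (hRM : 2 ≤ R * Mh) (a : BondIdx (domT hN D hk) → ℝ) (i' : BondIdx (domT hN D hk)) :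
    (∑ i, a i * QE (domT hN D hk) (bump hN D hk i) i') ^ 2 ≤
      (4 * ((d : ℝ) + 1) * (((ℓ + 1 : ℕ) : ℝ)) ^ (d + 1)) * ∑ i, (a i * QE (domT hN D hk) (bump hN D hk i) i') ^ 2 := by
  classical
  set S := Finset.univ.filter fun i : BondIdx (domT hN D hk) => QE (domT hN D hk) (bump hN D hk i) i' ≠ 0 with hSdef
  have hS : ∀ i, QE (domT hN D hk) (bump hN D hk i) i' ≠ 0 → i ∈ S := fun i hi => by rw [Finset.mem_filter]; exact ⟨Finset.mem_univ _, hi⟩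
  have hcard : (S.card : ℝ) ≤ 4 * ((d : ℝ) + 1) * (((ℓ + 1 : ℕ) : ℝ)) ^ (d + 1) := by
    have h : S.card ≤ 2 * (ℓ + 1) ^ (d + 1) * (2 * (d + 1)) := by rw [hSdef]; exact card_pair_support_le hN D hk hk1 hRM i'
    have : (S.card : ℝ) ≤ ((2 * (ℓ + 1) ^ (d + 1) * (2 * (d + 1)) : ℕ) : ℝ) := by exact_mod_cast h
    push_cast at this
    have hL : (((ℓ + 1 : ℕ) : ℝ)) = (ℓ : ℝ) + 1 := by push_cast; ring
    rw [hL]; linarith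
  refine (sq_sum_le_card_support_mul a _ S hS).trans ?_
  exact mul_le_mul_of_nonneg_right hcard (Finset.sum_nonneg fun i _ => sq_nonneg _)

end Locality

/-! ## §5b  Index bonds are determined by (level, direction, source block); the total same-level weight on a base block -/

section Keys

open B5Eq118OneStroke (iterBlock iterBlockOf mem_iterBlock mem_iterBlock_iff)
open B6MultiLevelBoxOperator (N0)
open B6MultiLevelTorusOperator (TDomains)
open B6GlobalChartV1 (PV domT)
open B6Ineq2142KLevelV1 (lvl lvl_le_mK one_le_lvl base cQ cQ_pos qwt qwt_nonneg qwt_eq_sum exists_of_qwt_ne_zero iterBlockOf_runSite_mem shift_injective)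

variable {d ℓ m K : ℕ} {hd : 1 ≤ d + 1} {hL : Odd (ℓ + 1) ∧ 1 < ℓ + 1}
variable {Mh k R : ℕ} {P' : Fin (d + 1) → ℕ}
variable (hN : ∀ μ, N0 ℓ Mh k P' μ = (PV d ℓ m K hd hL).sitesPerDir 0) (D : TDomains d ℓ Mh k P' R) (hk : k ≤ m + K)

/-- the source block of an index bond as a set of fine sites (a type-uniform key). [cite: Balaban1984PropagatorsII, (2.3)/(2.20) p.224–226, bookkeeping] -/
def srcBlk (i : BondIdx (domT hN D hk)) : Finset (Site (PV d ℓ m K hd hL) 0) := iterBlock (lvl hN D hk i) i.1.2.src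

/-- **AN INDEX BOND IS DETERMINED BY ITS LEVEL, DIRECTION AND SOURCE BLOCK.** [cite: Balaban1984PropagatorsII, (2.3)/(2.20) p.224–226, bookkeeping] -/
theorem ext_of_key {i i' : BondIdx (domT hN D hk)} (hj : lvl hN D hk i = lvl hN D hk i') (hdir : i.1.2.dir = i'.1.2.dir)
    (hblk : srcBlk hN D hk i = srcBlk hN D hk i') : i = i' := by
  obtain ⟨⟨j₀, b₀⟩, hb₀⟩ := i
  obtain ⟨⟨j₁, b₁⟩, hb₁⟩ := i'
  have hjj : j₀ = j₁ := Fin.ext (by simpa [lvl] using hj)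
  subst hjj
  simp only at hdir
  unfold srcBlk at hblk
  have hsrc : b₀.src = b₁.src := iterBlock_injective (lvl_le_mK hN D hk ⟨⟨j₀, b₀⟩, hb₀⟩) hblk
  have hb : b₀ = b₁ := by cases b₀; cases b₁; simp only at hsrc hdir; simp [hsrc, hdir]
  subst hb; rfl

/-- hence at most one index bond has a given (level, direction, source block). [cite: Balaban1984PropagatorsII, (2.3)/(2.20) p.224–226, bookkeeping] -/
theorem card_key_le_one (n : ℕ) (μ : Fin (d + 1)) (B : Finset (Site (PV d ℓ m K hd hL) 0)) :
    (Finset.univ.filter fun i : BondIdx (domT hN D hk) => lvl hN D hk i = n ∧ i.1.2.dir = μ ∧ srcBlk hN D hk i = B).card ≤ 1 := by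
  classical
  refine Finset.card_le_one.2 fun i hi i' hi' => ?_
  rw [Finset.mem_filter] at hi hi'
  exact ext_of_key hN D hk (hi.2.1.trans hi'.2.1.symm) (hi.2.2.1.trans hi'.2.2.1.symm) (hi.2.2.2.trans hi'.2.2.2.symm)

/-- the target block is the source block shifted: `B^j(b₊) ∋ z ⇔ B^j(b₋) = B^j(y(z) − e_μ)`. [cite: Balaban1984PropagatorsI, (1.7) p.18, bookkeeping] -/
theorem tgt_eq_iff_src_eq {n : ℕ} (b : PBond (PV d ℓ m K hd hL) n) (y : Site (PV d ℓ m K hd hL) n) : b.tgt = y ↔ b.src = y.unshift b.dir := by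
  unfold PBond.tgt
  constructor
  · intro h; rw [← h, B10StarCount.unshift_shift]
  · intro h; rw [h, B10StarCount.shift_unshift]

/-- **THE TOTAL SAME-LEVEL WEIGHT ON A FINE BOND IS AT MOST `c_Q·L^j`**: the level-`n`, direction-`μ` index bonds weighting the bond `⟨z, μ⟩` are
`⟨y(z), y(z)+e_μ⟩` (weight `c_Q(loc+1)`) and `⟨y(z)−e_μ, y(z)⟩` (weight `c_Q(L^n−1−loc)`). [cite: Balaban1984PropagatorsI, (1.18) p.20; Balaban1984PropagatorsII, (2.20) p.226] -/
theorem sum_qwt_level_le (n : ℕ) (hper : 2 ≤ (PV d ℓ m K hd hL).sitesPerDir n) (z : Site (PV d ℓ m K hd hL) 0) (μ : Fin (d + 1)) :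
    ∑ i' ∈ Finset.univ.filter (fun i' : BondIdx (domT hN D hk) => lvl hN D hk i' = n), qwt hN D hk i' ⟨z, μ⟩ ≤
      cQ (d := d) (ℓ := ℓ) n * (((ℓ + 1) ^ n : ℕ) : ℝ) := by
  classical
  by_cases hn : n ≤ m + K
  swap
  · -- no index bond has such a level
    have : Finset.univ.filter (fun i' : BondIdx (domT hN D hk) => lvl hN D hk i' = n) = ∅ := by
      refine Finset.filter_eq_empty_iff.2 fun i' _ h => hn ?_
      rw [← h]; exact lvl_le_mK hN D hk i'
    rw [this, Finset.sum_empty]; exact mul_nonneg (cQ_pos (d := d) (ℓ := ℓ) n).le (Nat.cast_nonneg _)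
  set y := iterBlockOf n z
  have hz : z ∈ iterBlock n y := by rw [mem_iterBlock]
  -- split the level-`n` bonds into: source block `B(y)`, source block `B(y − e_μ)` with direction `μ`, and the rest (weight 0)
  set A := Finset.univ.filter (fun i' : BondIdx (domT hN D hk) => lvl hN D hk i' = n ∧ i'.1.2.dir = μ ∧ srcBlk hN D hk i' = iterBlock n y)
  set Bset := Finset.univ.filter (fun i' : BondIdx (domT hN D hk) => lvl hN D hk i' = n ∧ i'.1.2.dir = μ ∧ srcBlk hN D hk i' = iterBlock n (y.unshift μ))
  have hA := card_key_le_one hN D hk n μ (iterBlock n y)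
  have hB := card_key_le_one hN D hk n μ (iterBlock n (y.unshift μ))
  have hval : ∀ i' ∈ Finset.univ.filter (fun i' : BondIdx (domT hN D hk) => lvl hN D hk i' = n), qwt hN D hk i' ⟨z, μ⟩ ≤
      (if i' ∈ A then cQ (d := d) (ℓ := ℓ) n * ((loc n z μ : ℝ) + 1) else 0) +
        (if i' ∈ Bset then cQ (d := d) (ℓ := ℓ) n * ((((ℓ + 1) ^ n - 1 - loc n z μ : ℕ) : ℝ)) else 0) := by
    intro i' hi'
    rw [Finset.mem_filter] at hi'
    have hlv : lvl hN D hk i' = n := hi'.2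
    by_cases hq : qwt hN D hk i' ⟨z, μ⟩ = 0
    · rw [hq]; refine add_nonneg ?_ ?_ <;> split_ifs
      · exact mul_nonneg (cQ_pos (d := d) (ℓ := ℓ) n).le (by positivity)
      · exact le_rfl
      · exact mul_nonneg (cQ_pos (d := d) (ℓ := ℓ) n).le (Nat.cast_nonneg _)
      · exact le_rfl
    · -- direction `μ` and `z` in the double block of `i′`
      have hdir : i'.1.2.dir = μ := by
        by_contra h; exact hq (qwt_eq_zero_of_dir_ne hN D hk i' (f := ⟨z, μ⟩) (fun h' => h h'.symm))
      obtain ⟨x, hx, t, ht, hxt⟩ := exists_of_qwt_ne_zero hN D hk i' hq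
      rw [mem_iterBlock] at hx
      have hzs : z = runSite x i'.1.2.dir t := by
        have := congrArg PBond.src hxt; exact this.symm
      rcases iterBlockOf_runSite_mem (lvl_le_mK hN D hk i') x i'.1.2.dir ht.le with h' | h'
      · -- `z ∈ B(src′)`: `i′ ∈ A`, weight `c_Q(loc + 1)`
        have hzsrc : z ∈ iterBlock (lvl hN D hk i') i'.1.2.src := by rw [mem_iterBlock, hzs, h', hx]
        have hmemA : i' ∈ A := by
          rw [Finset.mem_filter]
          refine ⟨Finset.mem_univ _, hlv, hdir, ?_⟩
          unfold srcBlk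
          rw [mem_iterBlock] at hzsrc
          have : iterBlock (lvl hN D hk i') i'.1.2.src = iterBlock (lvl hN D hk i') (iterBlockOf (lvl hN D hk i') z) := by rw [hzsrc]
          rw [this, hlv]
        rw [if_pos hmemA]
        have hw := qwt_src hN D hk i' (by rw [hlv]; exact hper) hzsrc
        rw [hdir, hlv] at hw
        rw [hw]
        refine le_add_of_nonneg_right ?_
        split_ifs
        · exact mul_nonneg (cQ_pos (d := d) (ℓ := ℓ) n).le (Nat.cast_nonneg _)
        · exact le_rfl
      · -- `z ∈ B(tgt′)`: `i′ ∈ B`, weight `c_Q(L^n − 1 − loc)`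
        have hztgt : z ∈ iterBlock (lvl hN D hk i') i'.1.2.tgt := by rw [mem_iterBlock, hzs, h', hx]; rfl
        have hmemB : i' ∈ Bset := by
          rw [Finset.mem_filter]
          refine ⟨Finset.mem_univ _, hlv, hdir, ?_⟩
          unfold srcBlk
          rw [mem_iterBlock] at hztgt
          have htgt : i'.1.2.tgt = iterBlockOf (lvl hN D hk i') z := hztgt.symm
          rw [tgt_eq_iff_src_eq] at htgt
          rw [htgt, hdir]
          -- align the level
          obtain ⟨⟨j₁, b₁⟩, hb₁⟩ := i'
          simp only [lvl] at hlv ⊢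
          subst hlv
          rfl
        rw [if_pos hmemB]
        have hw := qwt_tgt hN D hk i' (by rw [hlv]; exact hper) hztgt
        rw [hdir, hlv] at hw
        rw [hw]
        refine le_add_of_nonneg_left ?_
        split_ifs
        · exact mul_nonneg (cQ_pos (d := d) (ℓ := ℓ) n).le (by positivity)
        · exact le_rfl
  refine (Finset.sum_le_sum hval).trans ?_
  rw [Finset.sum_add_distrib]
  have hSA : ∑ i' ∈ Finset.univ.filter (fun i' : BondIdx (domT hN D hk) => lvl hN D hk i' = n),
      (if i' ∈ A then cQ (d := d) (ℓ := ℓ) n * ((loc n z μ : ℝ) + 1) else 0) ≤ cQ (d := d) (ℓ := ℓ) n * ((loc n z μ : ℝ) + 1) := by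
    rw [← Finset.sum_filter]
    have hsub : ((Finset.univ.filter (fun i' : BondIdx (domT hN D hk) => lvl hN D hk i' = n)).filter fun i' => i' ∈ A) ⊆ A :=
      fun i hi => (Finset.mem_filter.1 hi).2
    calc _ ≤ ∑ i' ∈ A, cQ (d := d) (ℓ := ℓ) n * ((loc n z μ : ℝ) + 1) :=
          Finset.sum_le_sum_of_subset_of_nonneg hsub fun _ _ _ => mul_nonneg (cQ_pos (d := d) (ℓ := ℓ) n).le (by positivity)
      _ = A.card * (cQ (d := d) (ℓ := ℓ) n * ((loc n z μ : ℝ) + 1)) := by rw [Finset.sum_const, nsmul_eq_mul]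
      _ ≤ 1 * (cQ (d := d) (ℓ := ℓ) n * ((loc n z μ : ℝ) + 1)) := by
          refine mul_le_mul_of_nonneg_right ?_ (mul_nonneg (cQ_pos (d := d) (ℓ := ℓ) n).le (by positivity)); exact_mod_cast hA
      _ = _ := one_mul _
  have hSB : ∑ i' ∈ Finset.univ.filter (fun i' : BondIdx (domT hN D hk) => lvl hN D hk i' = n),
      (if i' ∈ Bset then cQ (d := d) (ℓ := ℓ) n * ((((ℓ + 1) ^ n - 1 - loc n z μ : ℕ) : ℝ)) else 0) ≤
        cQ (d := d) (ℓ := ℓ) n * ((((ℓ + 1) ^ n - 1 - loc n z μ : ℕ) : ℝ)) := by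
    rw [← Finset.sum_filter]
    have hsub : ((Finset.univ.filter (fun i' : BondIdx (domT hN D hk) => lvl hN D hk i' = n)).filter fun i' => i' ∈ Bset) ⊆ Bset :=
      fun i hi => (Finset.mem_filter.1 hi).2
    calc _ ≤ ∑ i' ∈ Bset, cQ (d := d) (ℓ := ℓ) n * ((((ℓ + 1) ^ n - 1 - loc n z μ : ℕ) : ℝ)) :=
          Finset.sum_le_sum_of_subset_of_nonneg hsub fun _ _ _ => mul_nonneg (cQ_pos (d := d) (ℓ := ℓ) n).le (Nat.cast_nonneg _)
      _ = Bset.card * (cQ (d := d) (ℓ := ℓ) n * ((((ℓ + 1) ^ n - 1 - loc n z μ : ℕ) : ℝ))) := by rw [Finset.sum_const, nsmul_eq_mul]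
      _ ≤ 1 * (cQ (d := d) (ℓ := ℓ) n * ((((ℓ + 1) ^ n - 1 - loc n z μ : ℕ) : ℝ))) := by
          refine mul_le_mul_of_nonneg_right ?_ (mul_nonneg (cQ_pos (d := d) (ℓ := ℓ) n).le (Nat.cast_nonneg _)); exact_mod_cast hB
      _ = _ := one_mul _
  refine (add_le_add hSA hSB).trans (le_of_eq ?_)
  have hlt := loc_lt n z μ
  rw [← mul_add, Nat.cast_sub (by omega), Nat.cast_sub (Nat.one_le_pow _ _ (by omega))]
  push_cast; ring

/-- **THE SAME-LEVEL ROWS OF A BUMP CARRY TOTAL WEIGHT `≤ (L^j/(L^j − r))·m_i`**: `Σ_{i′ : j(i′) = j(i)} (Qφ_i)_{i′} ≤ c_Q·L^j·Στ·(Στ_⊥)^d`.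
[cite: Balaban1984PropagatorsII, (2.147) p.248; Balaban1984PropagatorsI, (1.18) p.20] -/
theorem sum_pair_level_le (i : BondIdx (domT hN D hk)) (hper : 2 ≤ (PV d ℓ m K hd hL).sitesPerDir (lvl hN D hk i)) :
    ∑ i' ∈ Finset.univ.filter (fun i' : BondIdx (domT hN D hk) => lvl hN D hk i' = lvl hN D hk i), QE (domT hN D hk) (bump hN D hk i) i' ≤
      cQ (d := d) (ℓ := ℓ) (lvl hN D hk i) * ((((ℓ + 1) ^ (lvl hN D hk i)) : ℕ) : ℝ) * (tsumL hN D hk i * Tsum (ℓ := ℓ) (lvl hN D hk i) ^ d) := by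
  classical
  simp_rw [QE_apply_eq_sum_qwt]
  rw [Finset.sum_comm]
  -- `Σ_f (Σ_{i′} q_{i′}(f))·φ_i(f) ≤ c_Q L^j Σ_f φ_i(f)`
  have h1 : ∀ f : PBond (PV d ℓ m K hd hL) 0,
      ∑ i' ∈ Finset.univ.filter (fun i' : BondIdx (domT hN D hk) => lvl hN D hk i' = lvl hN D hk i), qwt hN D hk i' f * bump hN D hk i f ≤
        cQ (d := d) (ℓ := ℓ) (lvl hN D hk i) * ((((ℓ + 1) ^ (lvl hN D hk i)) : ℕ) : ℝ) * bump hN D hk i f := by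
    intro f
    rw [← Finset.sum_mul]
    refine mul_le_mul_of_nonneg_right ?_ (bumpFn_nonneg hN D hk i f)
    obtain ⟨z, μ⟩ := f
    exact sum_qwt_level_le hN D hk (lvl hN D hk i) hper z μ
  refine (Finset.sum_le_sum fun f _ => h1 f).trans (le_of_eq ?_)
  rw [← Finset.mul_sum, pair_le.sum_bump]

end Keys

/-! ## §6c  The `Q`-part of the energy of one bump -/

section QEnergy

open B5Eq118OneStroke (iterBlock iterBlockOf mem_iterBlock)
open B6MultiLevelBoxOperator (N0)
open B6MultiLevelTorusOperator (TDomains)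
open B6GlobalChartV1 (PV domT)
open B6CubeWindowV1 (GlobalBand)
open B6Ineq2142KLevelV1 (lvl lvl_le lvl_le_mK one_le_lvl base cQ cQ_pos cQ_eq qwt qwt_nonneg)

variable {d ℓ m K : ℕ} {hd : 1 ≤ d + 1} {hL : Odd (ℓ + 1) ∧ 1 < ℓ + 1}
variable {Mh k R : ℕ} {P' : Fin (d + 1) → ℕ}
variable (hN : ∀ μ, N0 ℓ Mh k P' μ = (PV d ℓ m K hd hL).sitesPerDir 0) (D : TDomains d ℓ Mh k P' R) (hk : k ≤ m + K)

/-- the pairings are nonnegative. [cite: Balaban1984PropagatorsI, (1.18) p.20, bookkeeping] -/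
theorem pair_nonneg (i i' : BondIdx (domT hN D hk)) : 0 ≤ QE (domT hN D hk) (bump hN D hk i) i' := by
  rw [QE_apply_eq_sum_qwt]
  exact Finset.sum_nonneg fun f _ => mul_nonneg (qwt_nonneg hN D hk i' f) (bumpFn_nonneg hN D hk i f)

/-- `c_Q·L^j = L^{−jD}`. [cite: Balaban1984PropagatorsI, (1.18) p.20, bookkeeping] -/
theorem cQ_mul_pow (j : ℕ) : cQ (d := d) (ℓ := ℓ) j * ((((ℓ + 1) ^ j) : ℕ) : ℝ) = ((((ℓ + 1 : ℕ) : ℝ) ^ (d + 1)) ^ j)⁻¹ := by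
  unfold cQ
  have hb : ((((ℓ + 1 : ℕ) : ℝ)) ^ j) ≠ 0 := by positivity
  push_cast
  field_simp

/-- **THE TOTAL WEIGHT OF ALL ROWS ON A BUMP**: `Σ_{i′} (Qφ_i)_{i′} ≤ 2·L^{−jD}·Στ·(Στ_⊥)^d` (levels `j` and `j + 1` only, each `≤ c_QL^{j′}·Σφ`).
[cite: Balaban1984PropagatorsII, (2.147) p.248; Balaban1984PropagatorsI, (1.18) p.20] -/
theorem sum_pair_le (hk1 : 1 ≤ k) (hRM : 2 ≤ R * Mh) (hper : ∀ n, n ≤ k + 1 → 2 ≤ (PV d ℓ m K hd hL).sitesPerDir n) (i : BondIdx (domT hN D hk)) :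
    ∑ i', QE (domT hN D hk) (bump hN D hk i) i' ≤ 2 * ((((ℓ + 1 : ℕ) : ℝ) ^ (d + 1)) ^ (lvl hN D hk i))⁻¹ * (tsumL hN D hk i * Tsum (ℓ := ℓ) (lvl hN D hk i) ^ d) := by
  classical
  set j := lvl hN D hk i
  set F := Finset.univ.filter (fun i' : BondIdx (domT hN D hk) => lvl hN D hk i' = j) with hF
  set G := Finset.univ.filter (fun i' : BondIdx (domT hN D hk) => lvl hN D hk i' = j + 1) with hG
  -- only levels `j`, `j+1` contribute
  have hzero : ∀ i' ∈ Finset.univ \ (F ∪ G), QE (domT hN D hk) (bump hN D hk i) i' = 0 := by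
    intro i' hi'
    rw [Finset.mem_sdiff, Finset.mem_union, hF, hG, Finset.mem_filter, Finset.mem_filter] at hi'
    by_contra hne
    have hw := level_window hN D hk hk1 hRM i i' hne
    rcases Nat.eq_or_lt_of_le hw.1 with h | h
    · exact hi'.2 (Or.inl ⟨Finset.mem_univ _, h.symm⟩)
    · exact hi'.2 (Or.inr ⟨Finset.mem_univ _, by omega⟩)
  have hdisj : Disjoint F G := by
    rw [hF, hG, Finset.disjoint_filter]; intro i' _ h1 h2; omega
  have hsplit : ∑ i', QE (domT hN D hk) (bump hN D hk i) i' = ∑ i' ∈ F, QE (domT hN D hk) (bump hN D hk i) i' + ∑ i' ∈ G, QE (domT hN D hk) (bump hN D hk i) i' := by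
    rw [← Finset.sum_union hdisj, ← Finset.sum_sdiff (Finset.subset_univ (F ∪ G)), Finset.sum_eq_zero hzero, zero_add]
  rw [hsplit]
  have hj1 : j + 1 ≤ k + 1 := Nat.succ_le_succ (lvl_le hN D hk i)
  have h1 := sum_pair_level_le hN D hk i (hper j (by omega))
  -- the level `j+1` rows: same computation with `sum_qwt_level_le` at level `j + 1`
  have h2 : ∑ i' ∈ G, QE (domT hN D hk) (bump hN D hk i) i' ≤ cQ (d := d) (ℓ := ℓ) (j + 1) * ((((ℓ + 1) ^ (j + 1)) : ℕ) : ℝ) *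
      (tsumL hN D hk i * Tsum (ℓ := ℓ) j ^ d) := by
    simp_rw [QE_apply_eq_sum_qwt]
    rw [Finset.sum_comm]
    have h1' : ∀ f : PBond (PV d ℓ m K hd hL) 0, ∑ i' ∈ G, qwt hN D hk i' f * bump hN D hk i f ≤
        cQ (d := d) (ℓ := ℓ) (j + 1) * ((((ℓ + 1) ^ (j + 1)) : ℕ) : ℝ) * bump hN D hk i f := by
      intro f
      rw [← Finset.sum_mul]
      refine mul_le_mul_of_nonneg_right ?_ (bumpFn_nonneg hN D hk i f)
      obtain ⟨z, μ⟩ := f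
      exact sum_qwt_level_le hN D hk (j + 1) (hper (j + 1) hj1) z μ
    refine (Finset.sum_le_sum fun f _ => h1' f).trans (le_of_eq ?_)
    rw [← Finset.mul_sum, pair_le.sum_bump]
  rw [cQ_mul_pow] at h1 h2
  have hmono : ((((ℓ + 1 : ℕ) : ℝ) ^ (d + 1)) ^ (j + 1))⁻¹ ≤ ((((ℓ + 1 : ℕ) : ℝ) ^ (d + 1)) ^ j)⁻¹ := by
    refine inv_anti₀ (by positivity) (pow_le_pow_right₀ ?_ (Nat.le_succ j))
    exact_mod_cast Nat.one_le_pow _ _ (by omega)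
  have ht : 0 ≤ tsumL hN D hk i * Tsum (ℓ := ℓ) j ^ d :=
    mul_nonneg (Finset.sum_nonneg fun t _ => tauL_nonneg hN D hk i t) (pow_nonneg (Tsum_pos (ℓ := ℓ) j).le _)
  nlinarith [mul_le_mul_of_nonneg_right hmono ht]

end QEnergy

section QEnergy2

open B5Eq118OneStroke (iterBlock iterBlockOf mem_iterBlock)
open B6MultiLevelBoxOperator (N0)
open B6MultiLevelTorusOperator (TDomains)
open B6GlobalChartV1 (PV domT)
open B6Ineq2142KLevelV1 (lvl lvl_le lvl_le_mK one_le_lvl base cQ cQ_pos qwt qwt_nonneg)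

variable {d ℓ m K : ℕ} {hd : 1 ≤ d + 1} {hL : Odd (ℓ + 1) ∧ 1 < ℓ + 1}
variable {Mh k R : ℕ} {P' : Fin (d + 1) → ℕ}
variable (hN : ∀ μ, N0 ℓ Mh k P' μ = (PV d ℓ m K hd hL).sitesPerDir 0) (D : TDomains d ℓ Mh k P' R) (hk : k ≤ m + K)

/-- every row entry of a bump is `≤ L^{−jD}·Στ·(Στ_⊥)^d` (rows of level `< j` vanish). [cite: Balaban1984PropagatorsII, (2.147) p.248, bookkeeping] -/
theorem pair_le' (hk1 : 1 ≤ k) (hRM : 2 ≤ R * Mh) (i i' : BondIdx (domT hN D hk)) :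
    QE (domT hN D hk) (bump hN D hk i) i' ≤ ((((ℓ + 1 : ℕ) : ℝ) ^ (d + 1)) ^ (lvl hN D hk i))⁻¹ * (tsumL hN D hk i * Tsum (ℓ := ℓ) (lvl hN D hk i) ^ d) := by
  by_cases h0 : QE (domT hN D hk) (bump hN D hk i) i' = 0
  · rw [h0]
    exact mul_nonneg (by positivity) (mul_nonneg (Finset.sum_nonneg fun t _ => tauL_nonneg hN D hk i t) (pow_nonneg (Tsum_pos (ℓ := ℓ) _).le _))
  · have hw := level_window hN D hk hk1 hRM i i' h0
    refine ((le_abs_self _).trans (pair_le hN D hk i i')).trans (mul_le_mul_of_nonneg_right ?_ ?_)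
    · refine inv_anti₀ (by positivity) (pow_le_pow_right₀ ?_ hw.1)
      have hL1 : (1 : ℝ) ≤ ((ℓ + 1 : ℕ) : ℝ) := by exact_mod_cast Nat.succ_le_succ (Nat.zero_le ℓ)
      exact one_le_pow₀ hL1
    · exact mul_nonneg (Finset.sum_nonneg fun t _ => tauL_nonneg hN D hk i t) (pow_nonneg (Tsum_pos (ℓ := ℓ) _).le _)

/-- **THE `Q`-PART OF THE ENERGY OF ONE BUMP**: with the upper band `w_{i′} ≤ b₁c_f²L^{j′D}/L^{2j′}` ((2.16)),
`Σ_{i′} w_{i′}(Qφ_i)_{i′}² ≤ 2b₁c_f²L^D·L^{−2j}·L^{−jD}·(Στ(Στ_⊥)^d)²`. [cite: Balaban1984PropagatorsII, (2.16) p.225, (2.147) p.248] -/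
theorem qenergy_bump_le (hk1 : 1 ≤ k) (hRM : 2 ≤ R * Mh) (hper : ∀ n, n ≤ k + 1 → 2 ≤ (PV d ℓ m K hd hL).sitesPerDir n)
    {cf b₁ : ℝ} (hb₁ : 0 ≤ b₁) {w : BondIdx (domT hN D hk) → ℝ}
    (hwup : ∀ i', w i' ≤ b₁ * cf ^ 2 * (((ℓ + 1 : ℕ) : ℝ) ^ (d + 1)) ^ (lvl hN D hk i') / ((((ℓ + 1 : ℕ) : ℝ)) ^ (lvl hN D hk i')) ^ 2)
    (i : BondIdx (domT hN D hk)) :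
    ∑ i', w i' * QE (domT hN D hk) (bump hN D hk i) i' ^ 2 ≤
      2 * b₁ * cf ^ 2 * (((ℓ + 1 : ℕ) : ℝ)) ^ (d + 1) * (((((ℓ + 1 : ℕ) : ℝ)) ^ (lvl hN D hk i)) ^ 2)⁻¹ *
        ((((ℓ + 1 : ℕ) : ℝ) ^ (d + 1)) ^ (lvl hN D hk i))⁻¹ * (tsumL hN D hk i * Tsum (ℓ := ℓ) (lvl hN D hk i) ^ d) ^ 2 := by
  set j := lvl hN D hk i
  set Lr : ℝ := ((ℓ + 1 : ℕ) : ℝ) with hLr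
  set M := tsumL hN D hk i * Tsum (ℓ := ℓ) j ^ d with hM
  have hL1 : 1 ≤ Lr := by rw [hLr]; exact_mod_cast Nat.succ_le_succ (Nat.zero_le ℓ)
  have hL0 : 0 < Lr := lt_of_lt_of_le zero_lt_one hL1
  have hM0 : 0 ≤ M := mul_nonneg (Finset.sum_nonneg fun t _ => tauL_nonneg hN D hk i t) (pow_nonneg (Tsum_pos (ℓ := ℓ) _).le _)
  set wmax : ℝ := b₁ * cf ^ 2 * Lr ^ (d + 1) * (Lr ^ (d + 1)) ^ j / (Lr ^ j) ^ 2 with hwmax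
  set cmax : ℝ := ((Lr ^ (d + 1)) ^ j)⁻¹ * M with hcmax
  have hwmax0 : 0 ≤ wmax := by positivity
  have hcmax0 : 0 ≤ cmax := by positivity
  -- termwise: `w c² ≤ wmax·cmax·c`
  have hterm : ∀ i', w i' * QE (domT hN D hk) (bump hN D hk i) i' ^ 2 ≤ wmax * cmax * QE (domT hN D hk) (bump hN D hk i) i' := by
    intro i'
    by_cases h0 : QE (domT hN D hk) (bump hN D hk i) i' = 0
    · rw [h0]; simp
    · have hc0 := pair_nonneg hN D hk i i'
      have hwin := level_window hN D hk hk1 hRM i i' h0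
      have hc : QE (domT hN D hk) (bump hN D hk i) i' ≤ cmax := pair_le' hN D hk hk1 hRM i i'
      -- the weight bound at levels `j`, `j+1`
      have hwle : w i' ≤ wmax := by
        refine (hwup i').trans ?_
        rw [hwmax]
        have hj' : lvl hN D hk i' = j ∨ lvl hN D hk i' = j + 1 := by omega
        rw [div_le_div_iff₀ (by positivity) (by positivity)]
        rcases hj' with h | h
        · rw [h]
          have h1 : (1 : ℝ) ≤ Lr ^ (d + 1) := one_le_pow₀ hL1
          have h2 : 0 ≤ b₁ * cf ^ 2 * (Lr ^ (d + 1)) ^ j * (Lr ^ j) ^ 2 := by positivity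
          calc b₁ * cf ^ 2 * (Lr ^ (d + 1)) ^ j * (Lr ^ j) ^ 2 = 1 * (b₁ * cf ^ 2 * (Lr ^ (d + 1)) ^ j * (Lr ^ j) ^ 2) := by ring
            _ ≤ Lr ^ (d + 1) * (b₁ * cf ^ 2 * (Lr ^ (d + 1)) ^ j * (Lr ^ j) ^ 2) := mul_le_mul_of_nonneg_right h1 h2
            _ = _ := by ring
        · rw [h]
          have key : (Lr ^ j) ^ 2 ≤ (Lr ^ (j + 1)) ^ 2 := pow_le_pow_left₀ (by positivity) (pow_le_pow_right₀ hL1 (Nat.le_succ j)) 2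
          have h2 : 0 ≤ b₁ * cf ^ 2 * Lr ^ (d + 1) * (Lr ^ (d + 1)) ^ j := by positivity
          calc b₁ * cf ^ 2 * (Lr ^ (d + 1)) ^ (j + 1) * (Lr ^ j) ^ 2 = (b₁ * cf ^ 2 * Lr ^ (d + 1) * (Lr ^ (d + 1)) ^ j) * (Lr ^ j) ^ 2 := by ring
            _ ≤ (b₁ * cf ^ 2 * Lr ^ (d + 1) * (Lr ^ (d + 1)) ^ j) * (Lr ^ (j + 1)) ^ 2 := mul_le_mul_of_nonneg_left key h2
            _ = _ := by ring
      by_cases hw0 : 0 ≤ w i'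
      · calc w i' * QE (domT hN D hk) (bump hN D hk i) i' ^ 2 = (w i' * QE (domT hN D hk) (bump hN D hk i) i') * QE (domT hN D hk) (bump hN D hk i) i' := by ring
          _ ≤ (wmax * cmax) * QE (domT hN D hk) (bump hN D hk i) i' := by
              refine mul_le_mul_of_nonneg_right ?_ hc0
              exact mul_le_mul hwle hc hc0 hwmax0
          _ = _ := by ring
      · have h1 : w i' * QE (domT hN D hk) (bump hN D hk i) i' ^ 2 ≤ 0 := mul_nonpos_of_nonpos_of_nonneg (le_of_not_ge hw0) (sq_nonneg _)
        exact h1.trans (mul_nonneg (mul_nonneg hwmax0 hcmax0) hc0)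
  refine (Finset.sum_le_sum fun i' _ => hterm i').trans ?_
  rw [← Finset.mul_sum]
  have hsum := sum_pair_le hN D hk hk1 hRM hper i
  calc wmax * cmax * ∑ i', QE (domT hN D hk) (bump hN D hk i) i' ≤ wmax * cmax * (2 * ((Lr ^ (d + 1)) ^ j)⁻¹ * M) :=
        mul_le_mul_of_nonneg_left hsum (mul_nonneg hwmax0 hcmax0)
    _ = _ := by
        rw [hwmax, hcmax]
        field_simp

end QEnergy2

/-! ## §5c  The coarse rows: each fine bump is seen by ≤ 2 rows of level `j + 1`; each such row sees ≤ 2L^D fine bumps -/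

section Coarse

open B5Eq118OneStroke (iterBlock iterBlockOf mem_iterBlock card_iterBlock)
open B6MultiLevelBoxOperator (N0)
open B6MultiLevelTorusOperator (TDomains)
open B6GlobalChartV1 (PV domT toBox)
open B6Ineq2142KLevelV1 (lvl lvl_le lvl_le_mK one_le_lvl base other ends_eq baseSite iterBlockOf_baseSite lev_eq_of_base cQ qwt
  exists_of_qwt_ne_zero iterBlockOf_runSite_mem iterBlockOf_eq_of_le shift_injective)

variable {d ℓ m K : ℕ} {hd : 1 ≤ d + 1} {hL : Odd (ℓ + 1) ∧ 1 < ℓ + 1}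
variable {Mh k R : ℕ} {P' : Fin (d + 1) → ℕ}
variable (hN : ∀ μ, N0 ℓ Mh k P' μ = (PV d ℓ m K hd hL).sitesPerDir 0) (D : TDomains d ℓ Mh k P' R) (hk : k ≤ m + K)

/-- **A NONZERO ROW GIVES A WITNESS BOND**: `f₋` in the base block of `i`, in the double block of `i′`, same direction.
[cite: Balaban1984PropagatorsII, (2.147) p.248, bookkeeping] -/
theorem witness_of_pair_ne_zero (i i' : BondIdx (domT hN D hk)) (h : QE (domT hN D hk) (bump hN D hk i) i' ≠ 0) :
    i'.1.2.dir = i.1.2.dir ∧ ∃ z : Site (PV d ℓ m K hd hL) 0, iterBlockOf (lvl hN D hk i) z = base hN D hk i ∧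
      (iterBlockOf (lvl hN D hk i') z = i'.1.2.src ∨ iterBlockOf (lvl hN D hk i') z = i'.1.2.tgt) := by
  classical
  have hdir : i'.1.2.dir = i.1.2.dir := by
    by_contra hne; exact h (pair_eq_zero_of_dir_ne hN D hk i i' hne)
  rw [QE_apply_eq_sum_qwt] at h
  obtain ⟨f, -, hf⟩ := Finset.exists_ne_zero_of_sum_ne_zero h
  have hq : qwt hN D hk i' f ≠ 0 := left_ne_zero_of_mul hf
  have hb : bump hN D hk i f ≠ 0 := right_ne_zero_of_mul hf
  have hsrc := (bump_ne_zero_imp hN D hk i hb).2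
  rw [mem_iterBlock] at hsrc
  obtain ⟨x, hx, t, ht, hxt⟩ := exists_of_qwt_ne_zero hN D hk i' hq
  rw [mem_iterBlock] at hx
  have hs : f.src = runSite x i'.1.2.dir t := by rw [← hxt]; rfl
  refine ⟨hdir, f.src, hsrc, ?_⟩
  rcases iterBlockOf_runSite_mem (lvl_le_mK hN D hk i') x i'.1.2.dir ht.le with h' | h'
  · left; rw [hs, h', hx]
  · right; rw [hs, h', hx]; rfl

/-- **AT MOST TWO ROWS OF LEVEL `j+1` SEE THE BUMP `φ_i`** (their source block is the `(j+1)`-block over the base block of `i` or its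
`μ`-predecessor). [cite: Balaban1984PropagatorsII, (2.147) p.248, (2.1)–(2.3) p.224, bookkeeping] -/
theorem card_coarse_rows_le (i : BondIdx (domT hN D hk)) :
    (Finset.univ.filter fun i' : BondIdx (domT hN D hk) => lvl hN D hk i' = lvl hN D hk i + 1 ∧ QE (domT hN D hk) (bump hN D hk i) i' ≠ 0).card ≤ 2 := by
  classical
  set j := lvl hN D hk i
  set μ := i.1.2.dir
  set x₀ := baseSite hN D hk i
  set K1 := iterBlock (j + 1) (iterBlockOf (j + 1) x₀)
  set K2 := iterBlock (j + 1) ((iterBlockOf (j + 1) x₀).unshift μ)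
  have hsub : (Finset.univ.filter fun i' : BondIdx (domT hN D hk) => lvl hN D hk i' = j + 1 ∧ QE (domT hN D hk) (bump hN D hk i) i' ≠ 0) ⊆
      (Finset.univ.filter fun i' : BondIdx (domT hN D hk) => lvl hN D hk i' = j + 1 ∧ i'.1.2.dir = μ ∧ srcBlk hN D hk i' = K1) ∪
      (Finset.univ.filter fun i' : BondIdx (domT hN D hk) => lvl hN D hk i' = j + 1 ∧ i'.1.2.dir = μ ∧ srcBlk hN D hk i' = K2) := by
    intro i' hi'
    rw [Finset.mem_filter] at hi'
    obtain ⟨-, hj', hne⟩ := hi'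
    obtain ⟨hdir, z, hz, hends⟩ := witness_of_pair_ne_zero hN D hk i i' hne
    -- the `(j+1)`-block of `z` is that of `x₀`
    have hle : lvl hN D hk i ≤ lvl hN D hk i' := by rw [hj']; exact Nat.le_succ j
    have hzx : iterBlockOf (lvl hN D hk i') z = iterBlockOf (lvl hN D hk i') x₀ :=
      iterBlockOf_eq_of_le (n := lvl hN D hk i) (n' := lvl hN D hk i') hle (by rw [hz, iterBlockOf_baseSite])
    rw [Finset.mem_union, Finset.mem_filter, Finset.mem_filter]
    rcases hends with h | h
    · left
      refine ⟨Finset.mem_univ _, hj', hdir, ?_⟩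
      show iterBlock (lvl hN D hk i') i'.1.2.src = (fun n => iterBlock n (iterBlockOf n x₀)) (j + 1)
      rw [← hj']
      show iterBlock (lvl hN D hk i') i'.1.2.src = iterBlock (lvl hN D hk i') (iterBlockOf (lvl hN D hk i') x₀)
      rw [← hzx, h]
    · right
      refine ⟨Finset.mem_univ _, hj', hdir, ?_⟩
      have hsrc : i'.1.2.src = (iterBlockOf (lvl hN D hk i') z).unshift i'.1.2.dir := (tgt_eq_iff_src_eq i'.1.2 _).1 h.symm
      show iterBlock (lvl hN D hk i') i'.1.2.src = (fun n => iterBlock n ((iterBlockOf n x₀).unshift μ)) (j + 1)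
      rw [← hj']
      show iterBlock (lvl hN D hk i') i'.1.2.src = iterBlock (lvl hN D hk i') ((iterBlockOf (lvl hN D hk i') x₀).unshift μ)
      rw [hsrc, hzx, hdir]
  refine (Finset.card_le_card hsub).trans ((Finset.card_union_le _ _).trans ?_)
  have h1 := card_key_le_one hN D hk (j + 1) μ K1
  have h2 := card_key_le_one hN D hk (j + 1) μ K2
  omega

/-- **A FINE BUMP SEEN BY A COARSE ROW LIES IN THE NON-BASE END BLOCK OF THAT ROW**: `B^j(base i) ⊆ B^{j+1}(other i′)` (the base end of
`i′` has level `j+1` sites, the base block of `i` has level `j` sites). [cite: Balaban1984PropagatorsII, (2.1)–(2.3) p.224, (2.45) p.231] -/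
theorem baseBlk_subset_other (hk1 : 1 ≤ k) (i i' : BondIdx (domT hN D hk)) (hj : lvl hN D hk i' = lvl hN D hk i + 1)
    (h : QE (domT hN D hk) (bump hN D hk i) i' ≠ 0) :
    iterBlock (lvl hN D hk i) (base hN D hk i) ⊆ iterBlock (lvl hN D hk i') (other hN D hk i') := by
  obtain ⟨-, z, hz, hends⟩ := witness_of_pair_ne_zero hN D hk i i' h
  -- `z` is not under the base end of `i′`
  have hnot : iterBlockOf (lvl hN D hk i') z ≠ base hN D hk i' := by
    intro hb
    have h1 := lev_eq_of_base hN D hk hk1 i hz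
    have h2 := lev_eq_of_base hN D hk hk1 i' hb
    omega
  have hoth : iterBlockOf (lvl hN D hk i') z = other hN D hk i' := by
    rcases ends_eq hN D hk i' with ⟨hb, ho⟩ | ⟨hb, ho⟩
    · rw [ho]; rcases hends with h' | h'
      · exact absurd (h'.trans hb.symm) hnot
      · exact h'
    · rw [ho]; rcases hends with h' | h'
      · exact h'
      · exact absurd (h'.trans hb.symm) hnot
  intro x hx
  rw [mem_iterBlock] at hx ⊢
  rw [← hoth]
  exact iterBlockOf_eq_of_le (by rw [hj]; exact Nat.le_succ _) (hx.trans hz.symm)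

/-- **AT MOST `2L^D` FINE BUMPS OF DIRECTION `μ` ARE SEEN BY ONE COARSE ROW** (their base blocks are disjoint `j`-blocks of the non-base end,
`L^D` of them, two bumps per block). [cite: Balaban1984PropagatorsII, (2.147) p.248, (2.1)–(2.3) p.224, bookkeeping] -/
theorem card_fine_seen_le (hk1 : 1 ≤ k) (i' : BondIdx (domT hN D hk)) (hj1 : 1 ≤ lvl hN D hk i' - 1) :
    (Finset.univ.filter fun i : BondIdx (domT hN D hk) => lvl hN D hk i' = lvl hN D hk i + 1 ∧ QE (domT hN D hk) (bump hN D hk i) i' ≠ 0).card ≤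
      2 * (ℓ + 1) ^ (d + 1) := by
  classical
  set j' := lvl hN D hk i'
  set j := j' - 1 with hjdef
  set μ := i'.1.2.dir
  set T := iterBlock j' (other hN D hk i')
  have hj'm : j' ≤ m + K := lvl_le_mK hN D hk i'
  have hjm : j ≤ m + K := by omega
  -- the two families (case A: source block ⊆ T; case B: target block ⊆ T), keyed by their source block
  set FA := Finset.univ.filter fun i : BondIdx (domT hN D hk) => lvl hN D hk i = j ∧ i.1.2.dir = μ ∧ srcBlk hN D hk i ⊆ T
  set FB := Finset.univ.filter fun i : BondIdx (domT hN D hk) => lvl hN D hk i = j ∧ i.1.2.dir = μ ∧ iterBlock (lvl hN D hk i) i.1.2.tgt ⊆ T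
  have hsub : (Finset.univ.filter fun i : BondIdx (domT hN D hk) => lvl hN D hk i' = lvl hN D hk i + 1 ∧ QE (domT hN D hk) (bump hN D hk i) i' ≠ 0) ⊆ FA ∪ FB := by
    intro i hi
    rw [Finset.mem_filter] at hi
    obtain ⟨-, hji, hne⟩ := hi
    have hlv : lvl hN D hk i = j := by omega
    have hdir := (witness_of_pair_ne_zero hN D hk i i' hne).1
    have hsubT := baseBlk_subset_other hN D hk hk1 i i' hji hne
    rw [Finset.mem_union, Finset.mem_filter, Finset.mem_filter]
    by_cases hA : i.1.2.src ∈ (domT hN D hk).Om (lvl hN D hk i)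
    · left; refine ⟨Finset.mem_univ _, hlv, hdir.symm, ?_⟩
      unfold srcBlk; rwa [base_eq_src_of hN D hk i hA] at hsubT
    · right; refine ⟨Finset.mem_univ _, hlv, hdir.symm, ?_⟩
      rwa [base_eq_tgt_of hN D hk i hA] at hsubT
  -- disjoint-blocks counting inside `T`
  have hT : T.card = ((ℓ + 1) ^ (d + 1)) ^ j' := card_iterBlock _ hj'm _
  have hpow : ((ℓ + 1) ^ (d + 1)) ^ j' = ((ℓ + 1) ^ (d + 1)) ^ j * (ℓ + 1) ^ (d + 1) := by
    rw [← pow_succ]; congr 1; omega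
  have count : ∀ (F : Finset (BondIdx (domT hN D hk))) (blk : BondIdx (domT hN D hk) → Finset (Site (PV d ℓ m K hd hL) 0)),
      (∀ i ∈ F, blk i ⊆ T) → (∀ i ∈ F, (blk i).card = ((ℓ + 1) ^ (d + 1)) ^ j) →
      (∀ i ∈ F, ∀ i₂ ∈ F, i ≠ i₂ → Disjoint (blk i) (blk i₂)) → F.card ≤ (ℓ + 1) ^ (d + 1) := by
    intro F blk hsubF hcard hdisj
    have h1 : (F.biUnion blk).card = F.card * ((ℓ + 1) ^ (d + 1)) ^ j := by
      rw [Finset.card_biUnion hdisj, Finset.sum_congr rfl hcard, Finset.sum_const, smul_eq_mul]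
    have h2 : (F.biUnion blk).card ≤ T.card := Finset.card_le_card (Finset.biUnion_subset.2 hsubF)
    rw [h1, hT, hpow] at h2
    have h3 : F.card * ((ℓ + 1) ^ (d + 1)) ^ j ≤ (ℓ + 1) ^ (d + 1) * ((ℓ + 1) ^ (d + 1)) ^ j := by rw [mul_comm ((ℓ + 1) ^ (d + 1))]; exact h2
    exact Nat.le_of_mul_le_mul_right h3 (by positivity)
  have hA : FA.card ≤ (ℓ + 1) ^ (d + 1) := by
    refine count FA (srcBlk hN D hk) (fun i hi => (Finset.mem_filter.1 hi).2.2.2) (fun i hi => ?_) (fun i hi i₂ hi₂ hne => ?_)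
    · have hlv := (Finset.mem_filter.1 hi).2.1
      unfold srcBlk; rw [card_iterBlock _ (lvl_le_mK hN D hk i), hlv]
    · have h1 := Finset.mem_filter.1 hi
      have h2 := Finset.mem_filter.1 hi₂
      rw [Finset.disjoint_left]
      intro x hx hx2
      apply hne
      refine ext_of_key hN D hk (h1.2.1.trans h2.2.1.symm) (h1.2.2.1.trans h2.2.2.1.symm) ?_
      -- two blocks of the same level sharing a site coincide
      unfold srcBlk at hx hx2 ⊢
      rw [mem_iterBlock] at hx hx2
      obtain ⟨⟨j₁, b₁⟩, hb₁⟩ := i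
      obtain ⟨⟨j₂, b₂⟩, hb₂⟩ := i₂
      have hjj : j₁ = j₂ := Fin.ext (by have := h1.2.1.trans h2.2.1.symm; simpa [lvl] using this)
      subst hjj
      simp only [lvl] at hx hx2 ⊢
      rw [← hx, ← hx2]
  have hB : FB.card ≤ (ℓ + 1) ^ (d + 1) := by
    refine count FB (fun i => iterBlock (lvl hN D hk i) i.1.2.tgt) (fun i hi => (Finset.mem_filter.1 hi).2.2.2) (fun i hi => ?_) (fun i hi i₂ hi₂ hne => ?_)
    · have hlv := (Finset.mem_filter.1 hi).2.1
      show (iterBlock (lvl hN D hk i) i.1.2.tgt).card = _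
      rw [card_iterBlock _ (lvl_le_mK hN D hk i), hlv]
    · have h1 := Finset.mem_filter.1 hi
      have h2 := Finset.mem_filter.1 hi₂
      rw [Finset.disjoint_left]
      intro x hx hx2
      apply hne
      refine ext_of_key hN D hk (h1.2.1.trans h2.2.1.symm) (h1.2.2.1.trans h2.2.2.1.symm) ?_
      unfold srcBlk
      change x ∈ iterBlock (lvl hN D hk i) i.1.2.tgt at hx
      change x ∈ iterBlock (lvl hN D hk i₂) i₂.1.2.tgt at hx2
      rw [mem_iterBlock] at hx hx2
      obtain ⟨⟨j₁, b₁⟩, hb₁⟩ := i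
      obtain ⟨⟨j₂, b₂⟩, hb₂⟩ := i₂
      have hjj : j₁ = j₂ := Fin.ext (by have := h1.2.1.trans h2.2.1.symm; simpa [lvl] using this)
      subst hjj
      simp only [lvl] at hx hx2 h1 h2 ⊢
      have htgt : b₁.tgt = b₂.tgt := hx.symm.trans hx2
      have hdir : b₁.dir = b₂.dir := h1.2.2.1.trans h2.2.2.1.symm
      unfold PBond.tgt at htgt
      rw [hdir] at htgt
      rw [shift_injective b₂.dir htgt]
  calc _ ≤ (FA ∪ FB).card := Finset.card_le_card hsub
    _ ≤ FA.card + FB.card := Finset.card_union_le _ _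
    _ ≤ (ℓ + 1) ^ (d + 1) + (ℓ + 1) ^ (d + 1) := Nat.add_le_add hA hB
    _ = 2 * (ℓ + 1) ^ (d + 1) := by ring

end Coarse

end

end Literature.MathematicalPhysics.QuantumFieldTheory.Balaban1983to89.B6QGQTestBumpsKLevelV1
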